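import Literature.NumberTheory.Sieve.GreenTao2008MajorantProofs
import Literature.NumberTheory.Sieve.GreenTao2008Proofs
import HarnessLib

/-!
# Green–Tao (2008), §9: Proposition 9.8 (the linear forms condition) from Proposition 9.5

Trunk T-SIEVE. Sibling PROOFS file of `Literature.NumberTheory.Sieve.GreenTao2008Majorant`
(D-0014). That file reduced Green–Tao's Proposition 9.1 (`PseudorandomMajorant`) to the named
facts `MeasureLinearForms` (Prop. 9.8) and `MeasureCorrelation` (Prop. 9.10). Here we prove

  `MeasureLinearForms_of : GoldstonYildirimLinearForms → MeasureLinearForms`,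

i.e. Proposition 9.8 from Proposition 9.5 (the Goldston–Yıldırım linear forms asymptotic, kept
as a named fact), following the printed proof (B. Green, T. Tao, Ann. of Math. 167 (2008),
pp. 526–528) through a generic statement `linearFormsCondition_of_boxAsymptotic` which isolates
what the argument uses about the majorant: `ν_N = F_N` on the window `[ε₀N, 2ε₀N]` and `1`
outside, `F_N ≥ 0`, and the normalised asymptotic `E(∏_i F_N(ψ_i(x)) | x ∈ box) = 1 + o(1)`
for bounded non-degenerate integer systems on boxes with sides `≥ θ(N) = o(N)` (for `ν` of
Definition 9.3: `F_N(n) = (φ(W)/W) Λ_R(Wn+1)²/log R`, `θ(N) = R^{10 k 2^{k-1}} = N^{5/16}`).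

Contents, in the order of the printed proof:
* clearing denominators (`intMatrix`: `L'_{ij} = L_{ij} · L₀!`, an integer matrix with entries
  `≤ L₀ · L₀!`, nonzero non-proportional rows; `x = L₀! · y` is a bijection of `ℤ_N^t` for
  `N > L₀` prime) and the lift of `ℤ_N^t` to `[0, N)^t` (`sum_linearForms_eq_sum_Ico`);
* the `Q^t` boxes `B_u = ∏_j [⌈u_j N/Q⌉, ⌈(u_j+1)N/Q⌉)` (`boxLo`, `boxSide`, `box`), the
  partition `∑_{[0,N)^t} = ∑_u ∑_{B_u}` (`sum_eq_sum_boxes`), side lengths `N/Q ± 1`;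
* nice boxes (`box_sum_prod_nice`, with footnote 22: the multiple `s_i N` to subtract from
  `Ψ_i` is constant on the box and joins `b_i`) and the core application of the asymptotic to a
  sub-system (`box_linearForms_core`); non-nice boxes are `O(1)` (`box_sum_prod_le`, from
  `ν ≤ 1 + ∑_{|s| = O(1)} F_N(Ψ_i - sN)` and the asymptotic again);
* the proportion of non-nice boxes, in volume form: a point of a non-nice box lies within
  `O(N/Q)` of a hyperplane `Ψ_i = sN + aε₀N` (`exists_near_hyperplane_of_not_nice`), and such
  points number `O(N^t/Q)` (`card_filter_linearForm_le`, fibre by fibre along a coordinate with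
  `L'_{ij₀} ≠ 0`; `sum_card_box_le`);
* the assembly `linearFormsCondition_of_boxAsymptotic` (`Q` a large constant depending on `ε`,
  then `N` large) and `MeasureLinearForms_of` (growth bound
  `G = min(min_{m ≤ k2^{k-1}, t ≤ 3k-4} G_{9.5}(k,m,t), ⌊log_4 log N⌋)`; the coefficient bound
  `k · k! ≤ √(w(N))/2` holds for large `N` as `w → ∞`);
* the resulting reductions: `PseudorandomMajorant_of_goldstonYildirim` (Prop. 9.1 from
  Props. 9.5 and 9.6, with the sibling file's `MeasureCorrelation_of`) and
  `Literature.NumberTheory.Sieve.exists_prime_arithmetic_progression_of_goldstonYildirim` (Theorem 1.1 from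
  Theorem 3.5 and Props. 9.5, 9.6 — the p. 523 input being the proved
  `ModifiedVonMangoldtSum_holds`).

After this file the summit fact `Literature.NumberTheory.Sieve.exists_prime_arithmetic_progression` rests on exactly
three named facts of the source: Theorem 3.5 (`RelativeSzemeredi`, §§4–8, itself resting on
Szemerédi's theorem, Prop. 2.3) and the Goldston–Yıldırım Propositions 9.5 and 9.6 (§10 and the
Appendix).

## References

* B. Green, T. Tao, *The primes contain arbitrarily long arithmetic progressions*, Ann. of Math.
  (2) 167 (2008), 481–547: Proposition 9.8 and its proof, pp. 526–528 (with footnote 22).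
  [cite: GreenTaoAnnals2008]
-/

noncomputable section

open Filter Finset Topology
open scoped BigOperators

namespace Literature.NumberTheory.Sieve.GreenTao2008

/-! ### The `Q^t` boxes of the proof of Proposition 9.8 -/

/-- Lower end of the `v`-th of `Q` near-equal subintervals `[⌈vN/Q⌉, ⌈(v+1)N/Q⌉)` of `[0, N)`
(p. 527: "`x_j ∈ [u_j N/Q, (u_j + 1)N/Q)`"). [cite: GreenTaoAnnals2008, Proposition 9.8 (proof)] -/
def boxLo (N Q v : ℕ) : ℤ := ⌈((v * N : ℕ) : ℚ) / Q⌉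

/-- Side length `⌈(v+1)N/Q⌉ - ⌈vN/Q⌉` of the `v`-th subinterval.
[cite: GreenTaoAnnals2008, Proposition 9.8 (proof)] -/
def boxSide (N Q v : ℕ) : ℕ := (boxLo N Q (v + 1) - boxLo N Q v).toNat

/-- The box `B_{u_1, …, u_t} = ∏_j [⌈u_j N/Q⌉, ⌈(u_j+1)N/Q⌉)` (integer points), p. 527.
[cite: GreenTaoAnnals2008, Proposition 9.8 (proof)] -/
def box (N Q : ℕ) {t : ℕ} (u : Fin t → ℕ) : Finset (Fin t → ℤ) :=
  Fintype.piFinset fun j => Ico (boxLo N Q (u j)) (boxLo N Q (u j) + boxSide N Q (u j))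

/-- Unfolding `boxLo`. [cite: GreenTaoAnnals2008, Proposition 9.8 (proof)] -/
theorem boxLo_def (N Q v : ℕ) : boxLo N Q v = ⌈((v * N : ℕ) : ℚ) / Q⌉ := rfl

/-- `⌈0⌉ = 0`. [cite: GreenTaoAnnals2008, Proposition 9.8 (proof)] -/
theorem boxLo_zero (N Q : ℕ) : boxLo N Q 0 = 0 := by simp [boxLo]

/-- `⌈Q N / Q⌉ = N`. [cite: GreenTaoAnnals2008, Proposition 9.8 (proof)] -/
theorem boxLo_self {N Q : ℕ} (hQ : 0 < Q) : boxLo N Q Q = N := by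
  unfold boxLo
  have hQ' : (Q : ℚ) ≠ 0 := by exact_mod_cast hQ.ne'
  rw [show ((Q * N : ℕ) : ℚ) / Q = (N : ℤ) by push_cast; field_simp]
  exact Int.ceil_intCast _

/-- `⌈vN/Q⌉` is monotone in `v`. [cite: GreenTaoAnnals2008, Proposition 9.8 (proof)] -/
theorem boxLo_mono (N Q : ℕ) {v v' : ℕ} (h : v ≤ v') : boxLo N Q v ≤ boxLo N Q v' := by
  unfold boxLo
  exact Int.ceil_mono (div_le_div_of_nonneg_right (by exact_mod_cast Nat.mul_le_mul_right N h)
    (Nat.cast_nonneg Q))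

/-- `⌈vN/Q⌉ ≤ y ↔ vN ≤ yQ`. [cite: GreenTaoAnnals2008, Proposition 9.8 (proof)] -/
theorem boxLo_le_iff {N Q : ℕ} (hQ : 0 < Q) {v : ℕ} {y : ℤ} :
    boxLo N Q v ≤ y ↔ ((v * N : ℕ) : ℤ) ≤ y * Q := by
  unfold boxLo
  rw [Int.ceil_le, div_le_iff₀ (by exact_mod_cast hQ)]
  norm_cast

/-- `y < ⌈vN/Q⌉ ↔ yQ < vN`. [cite: GreenTaoAnnals2008, Proposition 9.8 (proof)] -/
theorem lt_boxLo_iff {N Q : ℕ} (hQ : 0 < Q) {v : ℕ} {y : ℤ} :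
    y < boxLo N Q v ↔ y * Q < ((v * N : ℕ) : ℤ) := by
  unfold boxLo
  rw [Int.lt_ceil, lt_div_iff₀ (by exact_mod_cast hQ)]
  norm_cast

/-- `⌈vN/Q⌉ + side(v) = ⌈(v+1)N/Q⌉`. [cite: GreenTaoAnnals2008, Proposition 9.8 (proof)] -/
theorem boxLo_add_boxSide (N Q v : ℕ) : boxLo N Q v + boxSide N Q v = boxLo N Q (v + 1) := by
  unfold boxSide
  rw [Int.toNat_of_nonneg (sub_nonneg.2 (boxLo_mono N Q (Nat.le_succ v)))]
  ring

/-- `N/Q - 1 ≤ side(v) ≤ N/Q + 1`. [cite: GreenTaoAnnals2008, Proposition 9.8 (proof)] -/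
theorem boxSide_bounds {N Q : ℕ} (hQ : 0 < Q) (v : ℕ) :
    (N : ℝ) / Q - 1 ≤ boxSide N Q v ∧ (boxSide N Q v : ℝ) ≤ (N : ℝ) / Q + 1 := by
  have hQ' : (0 : ℚ) < Q := by exact_mod_cast hQ
  have h1 : (((v * N : ℕ) : ℚ)) / Q ≤ boxLo N Q v := Int.le_ceil _
  have h2 : (boxLo N Q v : ℚ) < ((v * N : ℕ) : ℚ) / Q + 1 := Int.ceil_lt_add_one _
  have h3 : ((((v + 1) * N : ℕ) : ℚ)) / Q ≤ boxLo N Q (v + 1) := Int.le_ceil _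
  have h4 : (boxLo N Q (v + 1) : ℚ) < (((v + 1) * N : ℕ) : ℚ) / Q + 1 := Int.ceil_lt_add_one _
  have hside : (boxSide N Q v : ℚ) = boxLo N Q (v + 1) - boxLo N Q v := by
    have := boxLo_add_boxSide N Q v
    have h : ((boxSide N Q v : ℕ) : ℤ) = boxLo N Q (v + 1) - boxLo N Q v := by linarith
    exact_mod_cast h
  have hdiff : (((v + 1) * N : ℕ) : ℚ) / Q - ((v * N : ℕ) : ℚ) / Q = N / Q := by
    push_cast; field_simp; ring
  have hq : (N : ℚ) / Q - 1 ≤ boxSide N Q v ∧ (boxSide N Q v : ℚ) ≤ (N : ℚ) / Q + 1 := by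
    rw [hside]; constructor <;> linarith
  constructor
  · have h' : (((N : ℚ) / Q - 1 : ℚ) : ℝ) ≤ ((boxSide N Q v : ℚ) : ℝ) := Rat.cast_le.2 hq.1
    push_cast at h'
    exact h'
  · have h' : (((boxSide N Q v : ℚ)) : ℝ) ≤ (((N : ℚ) / Q + 1 : ℚ) : ℝ) := Rat.cast_le.2 hq.2
    push_cast at h'
    exact h'

/-- Membership in a box, coordinatewise. [cite: GreenTaoAnnals2008, Proposition 9.8 (proof)] -/
theorem mem_box_iff {N Q t : ℕ} {u : Fin t → ℕ} {Y : Fin t → ℤ} :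
    Y ∈ box N Q u ↔ ∀ j, boxLo N Q (u j) ≤ Y j ∧ Y j < boxLo N Q (u j + 1) := by
  unfold box
  simp only [Fintype.mem_piFinset, mem_Ico, boxLo_add_boxSide]

/-- The index of the box containing `Y ∈ [0, N)^t`: `u_j = ⌊Y_j Q / N⌋`.
[cite: GreenTaoAnnals2008, Proposition 9.8 (proof)] -/
def boxIndex (N Q : ℕ) {t : ℕ} (Y : Fin t → ℤ) : Fin t → ℕ := fun j => (Y j * Q / N).toNat

/-- For `0 ≤ y` : `⌈vN/Q⌉ ≤ y < ⌈(v+1)N/Q⌉ ↔ ⌊yQ/N⌋ = v`.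
[cite: GreenTaoAnnals2008, Proposition 9.8 (proof)] -/
theorem boxLo_le_and_lt_iff {N Q : ℕ} (hN : 0 < N) (hQ : 0 < Q) {v : ℕ} {y : ℤ} (hy : 0 ≤ y) :
    (boxLo N Q v ≤ y ∧ y < boxLo N Q (v + 1)) ↔ (y * Q / N).toNat = v := by
  rw [boxLo_le_iff hQ, lt_boxLo_iff hQ]
  have hN' : (0 : ℤ) < N := by exact_mod_cast hN
  have hyQ : 0 ≤ y * Q / N := Int.ediv_nonneg (mul_nonneg hy (Nat.cast_nonneg _)) hN'.le
  constructor
  · rintro ⟨h1, h2⟩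
    have h3 : (v : ℤ) ≤ y * Q / N := (Int.le_ediv_iff_mul_le hN').2 (by push_cast at h1; linarith)
    have h4 : y * Q / N < (v : ℤ) + 1 := (Int.ediv_lt_iff_lt_mul hN').2 (by push_cast at h2; linarith)
    have : y * Q / N = v := by omega
    rw [this, Int.toNat_natCast]
  · intro h
    have h' : y * Q / N = v := by rw [← h, Int.toNat_of_nonneg hyQ]
    constructor
    · have := (Int.le_ediv_iff_mul_le hN').1 h'.ge
      push_cast; linarith
    · have := (Int.ediv_lt_iff_lt_mul hN').1 (show y * Q / N < (v : ℤ) + 1 by omega)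
      push_cast; linarith

/-- Boxes lie in `[0, N)^t` (for `u_j < Q`). [cite: GreenTaoAnnals2008, Proposition 9.8 (proof)] -/
theorem box_subset {N Q t : ℕ} (hQ : 0 < Q) {u : Fin t → ℕ} (hu : ∀ j, u j < Q) :
    box N Q u ⊆ Fintype.piFinset fun _ : Fin t => Ico (0 : ℤ) N := by
  intro Y hY
  rw [mem_box_iff] at hY
  refine Fintype.mem_piFinset.2 fun j => mem_Ico.2 ⟨?_, ?_⟩
  · have h0 : (0 : ℤ) ≤ boxLo N Q (u j) := by
      rw [← boxLo_zero N Q]; exact boxLo_mono N Q (Nat.zero_le _)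
    exact h0.trans (hY j).1
  · have h1 : boxLo N Q (u j + 1) ≤ N := by
      rw [← boxLo_self hQ]; exact boxLo_mono N Q (hu j)
    exact (hY j).2.trans_le h1

/-- **Partition of `[0, N)^t` into the `Q^t` boxes** (p. 527): `∑_{Y ∈ [0,N)^t} G(Y) =
∑_{u ∈ [0,Q)^t} ∑_{Y ∈ B_u} G(Y)`. [cite: GreenTaoAnnals2008, Proposition 9.8 (proof)] -/
theorem sum_eq_sum_boxes {N Q t : ℕ} (hN : 0 < N) (hQ : 0 < Q) (G : (Fin t → ℤ) → ℝ) :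
    ∑ Y ∈ Fintype.piFinset (fun _ : Fin t => Ico (0 : ℤ) N), G Y =
      ∑ u ∈ Fintype.piFinset (fun _ : Fin t => range Q), ∑ Y ∈ box N Q u, G Y := by
  classical
  have hmaps : ∀ Y ∈ Fintype.piFinset (fun _ : Fin t => Ico (0 : ℤ) N),
      boxIndex N Q Y ∈ Fintype.piFinset (fun _ : Fin t => range Q) := by
    intro Y hY
    refine Fintype.mem_piFinset.2 fun j => mem_range.2 ?_
    obtain ⟨h0, h1⟩ := mem_Ico.1 (Fintype.mem_piFinset.1 hY j)
    unfold boxIndex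
    have hN' : (0 : ℤ) < N := by exact_mod_cast hN
    have : Y j * Q / N < Q := (Int.ediv_lt_iff_lt_mul hN').2 (by nlinarith)
    have h0' : 0 ≤ Y j * Q / N := Int.ediv_nonneg (mul_nonneg h0 (Nat.cast_nonneg _)) hN'.le
    exact (Int.toNat_lt h0').2 this
  rw [← sum_fiberwise_of_maps_to hmaps]
  refine sum_congr rfl fun u hu => sum_congr ?_ fun _ _ => rfl
  have hu' : ∀ j, u j < Q := fun j => mem_range.1 (Fintype.mem_piFinset.1 hu j)
  ext Y
  simp only [mem_filter]
  constructor
  · rintro ⟨hY, hidx⟩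
    rw [mem_box_iff]
    intro j
    have h0 : 0 ≤ Y j := (mem_Ico.1 (Fintype.mem_piFinset.1 hY j)).1
    exact (boxLo_le_and_lt_iff hN hQ h0).2 (by rw [← hidx]; rfl)
  · intro hY
    refine ⟨box_subset hQ hu' hY, funext fun j => ?_⟩
    have hYj := (mem_box_iff.1 hY) j
    have h00 : (0 : ℤ) ≤ boxLo N Q (u j) := by
      rw [← boxLo_zero N Q]; exact boxLo_mono N Q (Nat.zero_le _)
    have h0 : 0 ≤ Y j := h00.trans hYj.1
    exact (boxLo_le_and_lt_iff hN hQ h0).1 hYj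

/-- `#B_u = ∏_j side(u_j)`. [cite: GreenTaoAnnals2008, Proposition 9.8 (proof)] -/
theorem card_box (N Q : ℕ) {t : ℕ} (u : Fin t → ℕ) : #(box N Q u) = ∏ j, boxSide N Q (u j) := by
  unfold box
  rw [Fintype.card_piFinset]
  refine prod_congr rfl fun j _ => ?_
  rw [Int.card_Ico]
  simp

/-! ### Counting lattice points near a hyperplane (the "non-nice" boxes, p. 528) -/

/-- At most `2ρ + 1` integers `y` of a set satisfy `|α y + β| ≤ ρ` when `α ≠ 0` is an integer.
[folklore] -/
theorem card_filter_abs_mul_add_le (s : Finset ℤ) {α : ℤ} (hα : α ≠ 0) (β : ℝ) {ρ : ℝ} (hρ : 0 ≤ ρ) :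
    (#(s.filter fun y : ℤ => |(α : ℝ) * y + β| ≤ ρ) : ℝ) ≤ 2 * ρ + 1 := by
  classical
  set S := s.filter fun y : ℤ => |(α : ℝ) * y + β| ≤ ρ with hS
  rcases S.eq_empty_or_nonempty with h | hne
  · rw [h, card_empty]; push_cast; linarith
  set y₀ := S.min' hne with hy₀
  have hα1 : (1 : ℝ) ≤ |(α : ℝ)| := by
    rw [← Int.cast_abs]; exact_mod_cast Int.one_le_abs hα
  have hsub : S ⊆ Icc y₀ (y₀ + ⌊2 * ρ⌋) := by
    intro y hy
    have hmin : y₀ ≤ y := S.min'_le y hy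
    have hy' := (mem_filter.1 hy).2
    have hy₀' := (mem_filter.1 (S.min'_mem hne)).2
    have hdiff : |(α : ℝ)| * ((y : ℝ) - y₀) ≤ 2 * ρ := by
      have h1 : |((α : ℝ) * y + β) - ((α : ℝ) * y₀ + β)| ≤ ρ + ρ :=
        (abs_sub _ _).trans (add_le_add hy' hy₀')
      rw [show ((α : ℝ) * y + β) - ((α : ℝ) * y₀ + β) = α * (y - y₀) by ring, abs_mul,
        abs_of_nonneg (by exact_mod_cast sub_nonneg.2 hmin : (0 : ℝ) ≤ (y : ℝ) - y₀)] at h1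
      linarith
    have hyy : (y : ℝ) - y₀ ≤ 2 * ρ := by
      have h0 : (0 : ℝ) ≤ (y : ℝ) - y₀ := by exact_mod_cast sub_nonneg.2 hmin
      nlinarith
    refine mem_Icc.2 ⟨hmin, ?_⟩
    have : y - y₀ ≤ ⌊2 * ρ⌋ := Int.le_floor.2 (by push_cast; exact hyy)
    linarith
  calc (#S : ℝ) ≤ #(Icc y₀ (y₀ + ⌊2 * ρ⌋)) := by exact_mod_cast card_le_card hsub
    _ = ((⌊2 * ρ⌋ + 1).toNat : ℝ) := by rw [Int.card_Icc]; congr 2; ring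
    _ ≤ 2 * ρ + 1 := by
        have h0 : 0 ≤ ⌊2 * ρ⌋ + 1 := by
          have : 0 ≤ ⌊2 * ρ⌋ := Int.floor_nonneg.2 (by linarith); linarith
        have : (((⌊2 * ρ⌋ + 1).toNat : ℤ) : ℝ) = ((⌊2 * ρ⌋ + 1 : ℤ) : ℝ) := by
          rw [Int.toNat_of_nonneg h0]
        rw [Int.cast_natCast] at this
        rw [this]; push_cast; linarith [Int.floor_le (2 * ρ)]

/-- **Lattice points near a hyperplane** (the count of non-nice boxes, p. 528, in volume form):
for an integer form `Λ(Y) = ∑_j L_j Y_j` with `L_{j₀} ≠ 0`, at most `(2ρ + 1) N^{t-1}` points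
`Y ∈ [0, N)^t` satisfy `|Λ(Y) + β| ≤ ρ` (fibre by fibre along the `j₀`-th coordinate).
[cite: GreenTaoAnnals2008, Proposition 9.8 (proof, p. 528)] -/
theorem card_filter_linearForm_le {n N : ℕ} (j₀ : Fin (n + 1)) (Lr : Fin (n + 1) → ℤ)
    (hL : Lr j₀ ≠ 0) (β : ℝ) {ρ : ℝ} (hρ : 0 ≤ ρ) :
    (#((Fintype.piFinset fun _ : Fin (n + 1) => Ico (0 : ℤ) N).filter
        fun Y => |(∑ j, (Lr j : ℝ) * Y j) + β| ≤ ρ) : ℝ) ≤ (2 * ρ + 1) * (N : ℝ) ^ n := by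
  classical
  set T := (Fintype.piFinset fun _ : Fin (n + 1) => Ico (0 : ℤ) N).filter
    fun Y => |(∑ j, (Lr j : ℝ) * Y j) + β| ≤ ρ with hT
  set rm : (Fin (n + 1) → ℤ) → (Fin n → ℤ) := fun Y => Fin.removeNth j₀ Y with hrm
  have hcard := card_eq_sum_card_image rm T
  have hfib : ∀ Y' ∈ T.image rm, (#(T.filter fun Y => rm Y = Y') : ℝ) ≤ 2 * ρ + 1 := by
    intro Y' _
    set β' : ℝ := (∑ j : Fin n, (Lr (j₀.succAbove j) : ℝ) * Y' j) + β with hβ'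
    have hinj : Set.InjOn (fun Y : Fin (n + 1) → ℤ => Y j₀) ↑(T.filter fun Y => rm Y = Y') := by
      intro Y hY Z hZ hYZ
      have hY' := (mem_filter.1 (mem_coe.1 hY)).2
      have hZ' := (mem_filter.1 (mem_coe.1 hZ)).2
      simp only at hYZ
      rw [← Fin.insertNth_self_removeNth j₀ Y, ← Fin.insertNth_self_removeNth j₀ Z]
      simp only [hrm] at hY' hZ'
      rw [hYZ, hY', hZ']
    have hmaps : Set.MapsTo (fun Y : Fin (n + 1) → ℤ => Y j₀) ↑(T.filter fun Y => rm Y = Y')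
        ↑((Ico (0 : ℤ) N).filter fun y : ℤ => |(Lr j₀ : ℝ) * y + β'| ≤ ρ) := by
      intro Y hY
      obtain ⟨hT', hrm'⟩ := mem_filter.1 (mem_coe.1 hY)
      obtain ⟨hbox, hcond⟩ := mem_filter.1 hT'
      refine mem_coe.2 (mem_filter.2 ⟨Fintype.mem_piFinset.1 hbox j₀, ?_⟩)
      rw [Fin.sum_univ_succAbove _ j₀] at hcond
      have hY' : ∀ j, Y (j₀.succAbove j) = Y' j := fun j => by
        rw [← hrm']; rfl
      simp_rw [hY'] at hcond
      rwa [hβ', ← add_assoc]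
    calc (#(T.filter fun Y => rm Y = Y') : ℝ)
        ≤ #((Ico (0 : ℤ) N).filter fun y : ℤ => |(Lr j₀ : ℝ) * y + β'| ≤ ρ) := by
          exact_mod_cast card_le_card_of_injOn _ hmaps hinj
      _ ≤ 2 * ρ + 1 := card_filter_abs_mul_add_le _ hL β' hρ
  have himg : #(T.image rm) ≤ N ^ n := by
    have hsub : T.image rm ⊆ Fintype.piFinset fun _ : Fin n => Ico (0 : ℤ) N := by
      intro Y' hY'
      obtain ⟨Y, hY, rfl⟩ := mem_image.1 hY'
      have hbox := (mem_filter.1 hY).1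
      exact Fintype.mem_piFinset.2 fun j => Fintype.mem_piFinset.1 hbox _
    calc #(T.image rm) ≤ #(Fintype.piFinset fun _ : Fin n => Ico (0 : ℤ) N) := card_le_card hsub
      _ = N ^ n := by
          rw [Fintype.card_piFinset, prod_const, card_univ, Fintype.card_fin, Int.card_Ico]
          simp
  calc (#T : ℝ) = ∑ Y' ∈ T.image rm, (#(T.filter fun Y => rm Y = Y') : ℝ) := by
        rw [hcard]; push_cast; rfl
    _ ≤ ∑ _Y' ∈ T.image rm, (2 * ρ + 1) := sum_le_sum hfib
    _ = #(T.image rm) * (2 * ρ + 1) := by rw [sum_const, nsmul_eq_mul]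
    _ ≤ (N : ℝ) ^ n * (2 * ρ + 1) := by gcongr; exact_mod_cast himg
    _ = (2 * ρ + 1) * (N : ℝ) ^ n := mul_comm _ _


/-- Boxes with distinct indices are disjoint. [cite: GreenTaoAnnals2008, Proposition 9.8 (proof)] -/
theorem box_disjoint {N Q t : ℕ} {u u' : Fin t → ℕ} (h : u ≠ u') : Disjoint (box N Q u) (box N Q u') := by
  rw [disjoint_left]
  intro Y hY hY'
  apply h
  funext j
  have h1 := (mem_box_iff.1 hY) j
  have h2 := (mem_box_iff.1 hY') j
  by_contra hne
  rcases lt_or_gt_of_ne hne with hlt | hlt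
  · have := boxLo_mono N Q (Nat.succ_le_of_lt hlt)
    exact absurd (h1.2.trans_le (this.trans h2.1)) (lt_irrefl _)
  · have := boxLo_mono N Q (Nat.succ_le_of_lt hlt)
    exact absurd (h2.2.trans_le (this.trans h1.1)) (lt_irrefl _)

/-! ### Clearing denominators (p. 527, first paragraph of the proof) -/

/-- The integer matrix `L'_{ij} = L_{ij} · L₀!` obtained by clearing denominators ("We may clear
denominators and assume that all the `L_{ij}` are integers, at the expense of increasing the bound
on `L_{ij}` to `|L_{ij}| ≤ (k+1)!`", p. 527; here the bound is `L₀ · L₀!`).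
[cite: GreenTaoAnnals2008, Proposition 9.8 (proof)] -/
def intMatrix (L₀ : ℕ) {m t : ℕ} (L : Fin m → Fin t → ℚ) : Fin m → Fin t → ℤ :=
  fun i j => (L i j).num * ((L₀.factorial / (L i j).den : ℕ) : ℤ)

/-- `L'_{ij} = L_{ij} · L₀!` in `ℚ`. [cite: GreenTaoAnnals2008, Proposition 9.8 (proof)] -/
theorem intMatrix_cast {L₀ m t : ℕ} {L : Fin m → Fin t → ℚ}
    (hL : ∀ i j, (L i j).num.natAbs ≤ L₀ ∧ (L i j).den ≤ L₀) (i : Fin m) (j : Fin t) :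
    (intMatrix L₀ L i j : ℚ) = L i j * L₀.factorial := by
  have hden0 : ((L i j).den : ℚ) ≠ 0 := by exact_mod_cast (Rat.den_pos _).ne'
  have hdvd : (L i j).den ∣ L₀.factorial := Nat.dvd_factorial (Rat.den_pos _) (hL i j).2
  have h1 : (((L₀.factorial / (L i j).den : ℕ) : ℤ) : ℚ) = (L₀.factorial : ℚ) / (L i j).den := by
    rw [Int.cast_natCast, Nat.cast_div hdvd hden0]
  simp only [intMatrix, Int.cast_mul, h1]
  conv_rhs => rw [← Rat.num_div_den (L i j)]
  ring

/-- `|L'_{ij}| ≤ L₀ · L₀!`. [cite: GreenTaoAnnals2008, Proposition 9.8 (proof)] -/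
theorem abs_intMatrix_le {L₀ m t : ℕ} {L : Fin m → Fin t → ℚ}
    (hL : ∀ i j, (L i j).num.natAbs ≤ L₀ ∧ (L i j).den ≤ L₀) (i : Fin m) (j : Fin t) :
    |intMatrix L₀ L i j| ≤ L₀ * L₀.factorial := by
  simp only [intMatrix, abs_mul]
  have h1 : |(L i j).num| ≤ L₀ := by
    rw [Int.abs_eq_natAbs]; exact_mod_cast (hL i j).1
  have h2 : |((L₀.factorial / (L i j).den : ℕ) : ℤ)| ≤ (L₀.factorial : ℤ) := by
    rw [abs_of_nonneg (by positivity)]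
    exact_mod_cast Nat.div_le_self _ _
  calc |(L i j).num| * |((L₀.factorial / (L i j).den : ℕ) : ℤ)| ≤ L₀ * (L₀.factorial : ℤ) :=
        mul_le_mul h1 h2 (abs_nonneg _) (by positivity)
    _ = ((L₀ * L₀.factorial : ℕ) : ℤ) := (Nat.cast_mul _ _).symm

/-- The rows of `L'` are nonzero. [cite: GreenTaoAnnals2008, Proposition 9.8 (proof)] -/
theorem intMatrix_ne_zero {L₀ m t : ℕ} {L : Fin m → Fin t → ℚ}
    (hL : ∀ i j, (L i j).num.natAbs ≤ L₀ ∧ (L i j).den ≤ L₀) (hL0 : ∀ i, L i ≠ 0) (i : Fin m) :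
    intMatrix L₀ L i ≠ 0 := by
  intro h0
  apply hL0 i
  funext j
  have h1 : intMatrix L₀ L i j = 0 := by simpa using congrFun h0 j
  have hq := intMatrix_cast hL i j
  rw [h1, Int.cast_zero] at hq
  have hD : (L₀.factorial : ℚ) ≠ 0 := by positivity
  have : L i j * L₀.factorial = 0 := hq.symm
  simpa [hD] using this

/-- The rows of `L'` are pairwise not rational multiples of each other.
[cite: GreenTaoAnnals2008, Proposition 9.8 (proof)] -/
theorem intMatrix_not_prop {L₀ m t : ℕ} {L : Fin m → Fin t → ℚ}
    (hL : ∀ i j, (L i j).num.natAbs ≤ L₀ ∧ (L i j).den ≤ L₀)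
    (hLp : ∀ i i', i ≠ i' → ∀ c : ℚ, L i ≠ c • L i') (i i' : Fin m) (hii' : i ≠ i') (c : ℚ) :
    (fun j => (intMatrix L₀ L i j : ℚ)) ≠ c • fun j => (intMatrix L₀ L i' j : ℚ) := by
  intro h
  apply hLp i i' hii' c
  funext j
  have h1 := congrFun h j
  simp only [Pi.smul_apply, smul_eq_mul, intMatrix_cast hL] at h1
  have hD : (L₀.factorial : ℚ) ≠ 0 := by positivity
  have h2 : L i j * L₀.factorial = (c * L i' j) * L₀.factorial := by rw [h1]; ring
  have := mul_right_cancel₀ hD h2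
  simpa [Pi.smul_apply, smul_eq_mul] using this

/-- In `ℤ_N`, `N > L₀` prime: `L_{ij} · L₀! = L'_{ij}` (the denominators are invertible).
[cite: GreenTaoAnnals2008, Proposition 9.8 (proof)] -/
theorem ratCast_mul_factorial {L₀ m t N : ℕ} [Fact N.Prime] {L : Fin m → Fin t → ℚ}
    (hL : ∀ i j, (L i j).num.natAbs ≤ L₀ ∧ (L i j).den ≤ L₀) (hN : L₀ < N) (i : Fin m) (j : Fin t) :
    ((L i j : ℚ) : ZMod N) * (L₀.factorial : ZMod N) = ((intMatrix L₀ L i j : ℤ) : ZMod N) := by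
  have hdvd : (L i j).den ∣ L₀.factorial := Nat.dvd_factorial (Rat.den_pos _) (hL i j).2
  have hden0 : ((L i j).den : ZMod N) ≠ 0 := by
    intro h
    rw [ZMod.natCast_eq_zero_iff] at h
    have h1 := Nat.le_of_dvd (Rat.den_pos _) h
    have h2 := (hL i j).2
    omega
  rw [Rat.cast_def]
  have hDfac : (L₀.factorial : ZMod N) =
      ((L i j).den : ZMod N) * ((L₀.factorial / (L i j).den : ℕ) : ZMod N) := by
    rw [← Nat.cast_mul, Nat.mul_div_cancel' hdvd]
  rw [hDfac, ← mul_assoc, div_mul_cancel₀ _ hden0]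
  simp only [intMatrix, Int.cast_mul, Int.cast_natCast]

/-- **Change of variables and lift** (p. 527): for `N > L₀` prime and `b ∈ ℤ_N^m`,
`∑_{x ∈ ℤ_N^t} ∏_i ν(ψ_i(x)) = ∑_{Y ∈ [0,N)^t} ∏_i ν(Ψ_i(Y) mod N)` with the integer forms
`Ψ_i(Y) = ∑_j L'_{ij} Y_j + b̃_i` (`x = L₀! · y`, a bijection of `ℤ_N^t`; `Y_j`, `b̃_i` the
representatives in `[0, N)`). [cite: GreenTaoAnnals2008, Proposition 9.8 (proof)] -/
theorem sum_linearForms_eq_sum_Ico {L₀ m t N : ℕ} [Fact N.Prime] (ν₁ : ZMod N → ℝ)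
    {L : Fin m → Fin t → ℚ} (hL : ∀ i j, (L i j).num.natAbs ≤ L₀ ∧ (L i j).den ≤ L₀) (hN : L₀ < N)
    (b : Fin m → ZMod N) :
    ∑ x : Fin t → ZMod N, ∏ i, ν₁ (∑ j, ((L i j : ℚ) : ZMod N) * x j + b i) =
      ∑ Y ∈ Fintype.piFinset (fun _ : Fin t => Ico (0 : ℤ) N),
        ∏ i, ν₁ ((∑ j, intMatrix L₀ L i j * Y j + ((b i).val : ℤ) : ℤ) : ZMod N) := by
  classical
  have hNp : N.Prime := Fact.out
  have hDunit : IsUnit (L₀.factorial : ZMod N) := by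
    rw [isUnit_iff_ne_zero, Ne, ZMod.natCast_eq_zero_iff, hNp.dvd_factorial]
    omega
  set e : (Fin t → ZMod N) ≃ (Fin t → ZMod N) :=
    Equiv.piCongrRight fun _ => hDunit.unit.mulLeft with he_def
  have he : ∀ y j, e y j = (L₀.factorial : ZMod N) * y j := by
    intro y j
    simp [he_def, Units.mulLeft_apply, IsUnit.unit_spec]
  -- `x = L₀! · y`
  have h1 : ∑ x : Fin t → ZMod N, ∏ i, ν₁ (∑ j, ((L i j : ℚ) : ZMod N) * x j + b i) =
      ∑ y : Fin t → ZMod N, ∏ i, ν₁ (∑ j, ((intMatrix L₀ L i j : ℤ) : ZMod N) * y j + b i) := by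
    rw [← Equiv.sum_comp e]
    refine sum_congr rfl fun y _ => prod_congr rfl fun i _ => ?_
    rw [show (∑ j, ((L i j : ℚ) : ZMod N) * e y j) = ∑ j, ((intMatrix L₀ L i j : ℤ) : ZMod N) * y j
      from Fintype.sum_congr _ _ fun j => by rw [he, ← mul_assoc, ratCast_mul_factorial hL hN]]
  rw [h1]
  -- lift `y ↦ (y_j.val)_j`
  refine sum_nbij (fun y => fun j => ((y j).val : ℤ)) ?_ ?_ ?_ ?_
  · intro y _
    exact Fintype.mem_piFinset.2 fun j => mem_Ico.2 ⟨by positivity, by exact_mod_cast ZMod.val_lt _⟩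
  · intro y _ y' _ h
    funext j
    have h' := congrFun h j
    simp only [Nat.cast_inj] at h'
    exact ZMod.val_injective N h'
  · intro Y hY
    refine ⟨fun j => (((Y j).toNat : ℕ) : ZMod N), mem_coe.2 (mem_univ _), ?_⟩
    funext j
    obtain ⟨h0, h1⟩ := mem_Ico.1 (Fintype.mem_piFinset.1 (mem_coe.1 hY) j)
    simp only
    rw [ZMod.val_cast_of_lt ((Int.toNat_lt h0).2 h1), Int.toNat_of_nonneg h0]
  · intro y _
    refine prod_congr rfl fun i _ => ?_
    congr 1
    push_cast
    simp only [ZMod.natCast_val, ZMod.cast_id', id_eq]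

/-! ### The box-level steps of the proof of Proposition 9.8 -/

/-- The window `[ε₀ N, 2ε₀ N]` on which `ν = F` (Definition 9.3, with `ε₀ = ε_k`).
[cite: GreenTaoAnnals2008, Definition 9.3] -/
abbrev InWindow (ε₀ : ℝ) (N : ℕ) (r : ℤ) : Prop := ε₀ * N ≤ (r : ℝ) ∧ (r : ℝ) ≤ 2 * ε₀ * N

/-- Unfolding `InWindow`. [cite: GreenTaoAnnals2008, Definition 9.3] -/
theorem inWindow_iff (ε₀ : ℝ) (N : ℕ) (r : ℤ) :
    InWindow ε₀ N r ↔ ε₀ * N ≤ (r : ℝ) ∧ (r : ℝ) ≤ 2 * ε₀ * N := Iff.rfl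

/-- **Nice boxes are evaluated by the linear forms asymptotic** (p. 527, with footnote 22),
core step: on a box `B_u` with sides `≥ θ(N)`, for any sub-family `A` of the integer forms
`Ψ_i(Y) = ∑_j L'_{ij} Y_j + b̃_i` and any constant shifts `σ_i N`,
`|∑_{Y ∈ B_u} ∏_{i ∈ A} F(Ψ_i(Y) - σ_i N) - #B_u| ≤ ε' #B_u`.
[cite: GreenTaoAnnals2008, Proposition 9.8 (proof, p. 527 and footnote 22)] -/
theorem box_linearForms_core {N Q n m L₀ : ℕ} (Fn : ℤ → ℝ) {θN ε' : ℝ}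
    (L' : Fin m → Fin (n + 1) → ℤ) (hL'bd : ∀ i j, |L' i j| ≤ L₀ * L₀.factorial)
    (hL'0 : ∀ i, L' i ≠ 0)
    (hL'p : ∀ i i', i ≠ i' → ∀ c : ℚ, (fun j => (L' i j : ℚ)) ≠ c • fun j => (L' i' j : ℚ))
    (B : Fin m → ℤ)
    (hHLF : ∀ m' ∈ Icc 1 m, ∀ L'' : Fin m' → Fin (n + 1) → ℤ,
      (∀ i j, |L'' i j| ≤ L₀ * L₀.factorial) → (∀ i, L'' i ≠ 0) →
        (∀ i i', i ≠ i' → ∀ c : ℚ, (fun j => (L'' i j : ℚ)) ≠ c • fun j => (L'' i' j : ℚ)) →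
        ∀ b'' : Fin m' → ℤ, ∀ a : Fin (n + 1) → ℤ, ∀ ℓ : Fin (n + 1) → ℕ, (∀ j, θN ≤ ℓ j) →
          |(𝔼 x ∈ Fintype.piFinset fun j => Ico (a j) (a j + ℓ j),
              ∏ i, Fn (∑ j, L'' i j * x j + b'' i)) - 1| ≤ ε')
    (hside : ∀ v, θN ≤ boxSide N Q v) (hpos : ∀ u : Fin (n + 1) → ℕ, 0 < #(box N Q u))
    (hε' : 0 ≤ ε') (u : Fin (n + 1) → ℕ) (A : Finset (Fin m)) (σ : Fin m → ℤ) :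
    |∑ Y ∈ box N Q u, ∏ i ∈ A, Fn (∑ j, L' i j * Y j + B i - σ i * N) - #(box N Q u)| ≤
      ε' * #(box N Q u) := by
  classical
  rcases A.eq_empty_or_nonempty with rfl | hAne
  · simp only [prod_empty, sum_const, nsmul_eq_mul, mul_one, sub_self, abs_zero]
    positivity
  set m' : ℕ := #A with hm'_def
  have hm'1 : 1 ≤ m' := card_pos.2 hAne
  have hm'm : m' ≤ m := by simpa using card_le_univ A
  set eA : Fin m' ≃ A := A.equivFin.symm with heA_def
  have h := hHLF m' (mem_Icc.2 ⟨hm'1, hm'm⟩) (fun k j => L' (eA k) j) (fun k j => hL'bd _ _)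
    (fun k => hL'0 _) (fun k k' hkk' c => hL'p _ _ (fun heq => hkk' (eA.injective (Subtype.ext heq))) c)
    (fun k => B (eA k) - σ (eA k) * N) (fun j => boxLo N Q (u j)) (fun j => boxSide N Q (u j))
    (fun j => hside (u j))
  change |(𝔼 x ∈ box N Q u, ∏ k, Fn (∑ j, L' (eA k) j * x j + (B (eA k) - σ (eA k) * N))) - 1| ≤ ε'
    at h
  have hprod : ∀ Y : Fin (n + 1) → ℤ, ∏ k, Fn (∑ j, L' (eA k) j * Y j + (B (eA k) - σ (eA k) * N)) =
      ∏ i ∈ A, Fn (∑ j, L' i j * Y j + B i - σ i * N) := by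
    intro Y
    rw [← prod_coe_sort A]
    refine Fintype.prod_equiv eA _ _ (fun k => ?_)
    rw [add_sub_assoc']
  simp_rw [hprod] at h
  have hc0 : (0 : ℝ) < #(box N Q u) := by exact_mod_cast hpos u
  rw [expect_eq_sum_div_card] at h
  have heq : ∑ Y ∈ box N Q u, ∏ i ∈ A, Fn (∑ j, L' i j * Y j + B i - σ i * N) - #(box N Q u) =
      ((∑ Y ∈ box N Q u, ∏ i ∈ A, Fn (∑ j, L' i j * Y j + B i - σ i * N)) / #(box N Q u) - 1) *
        #(box N Q u) := by
    field_simp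
  rw [heq, abs_mul, abs_of_pos hc0]
  exact mul_le_mul_of_nonneg_right h hc0.le

/-- **Non-nice boxes contribute `O(1)`** (p. 527: "we can crudely bound `ν` by
`1 + (φ(W)/W log R) Λ_R²(θ_i(x))`, multiply out, and apply Proposition 9.5 again"): if
`ν(Ψ_i(Y)) ≤ ∑_{s ∈ S₀} (F(Ψ_i(Y) - sN) + 1/#S₀)` on the box and the core estimate holds with
`ε' ≤ 1`, then `∑_{Y ∈ B_u} ∏_i ν(Ψ_i(Y)) ≤ 2 (2 #S₀)^m #B_u`.
[cite: GreenTaoAnnals2008, Proposition 9.8 (proof, p. 527)] -/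
theorem box_sum_prod_le {N Q n m : ℕ} (νZ Fn : ℤ → ℝ) (Ψ : Fin m → (Fin (n + 1) → ℤ) → ℤ)
    (S₀ : Finset ℤ) {ε' : ℝ} (hS₀ : S₀.Nonempty) (hν0 : ∀ z, 0 ≤ νZ z) (hF0 : ∀ z, 0 ≤ Fn z)
    (u : Fin (n + 1) → ℕ)
    (hνle : ∀ Y ∈ box N Q u, ∀ i, νZ (Ψ i Y) ≤ ∑ s ∈ S₀, (Fn (Ψ i Y - s * N) + (#S₀ : ℝ)⁻¹))
    (hCORE : ∀ (A : Finset (Fin m)) (σ : Fin m → ℤ),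
      |∑ Y ∈ box N Q u, ∏ i ∈ A, Fn (Ψ i Y - σ i * N) - #(box N Q u)| ≤ ε' * #(box N Q u))
    (hε'1 : ε' ≤ 1) :
    ∑ Y ∈ box N Q u, ∏ i, νZ (Ψ i Y) ≤ ((#S₀ : ℝ) ^ m * 2 ^ m * 2) * #(box N Q u) := by
  classical
  have hS₀pos : (0 : ℝ) < #S₀ := by exact_mod_cast card_pos.2 hS₀
  have hS₀1 : (1 : ℝ) ≤ #S₀ := by exact_mod_cast card_pos.2 hS₀
  have hpt : ∀ Y ∈ box N Q u, ∏ i, νZ (Ψ i Y) ≤ ∑ σ ∈ Fintype.piFinset (fun _ : Fin m => S₀),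
      ∑ A ∈ (univ : Finset (Fin m)).powerset, ∏ i ∈ A, Fn (Ψ i Y - σ i * N) := by
    intro Y hY
    calc ∏ i, νZ (Ψ i Y) ≤ ∏ i, ∑ s ∈ S₀, (Fn (Ψ i Y - s * N) + (#S₀ : ℝ)⁻¹) :=
          prod_le_prod (fun i _ => hν0 _) (fun i _ => hνle Y hY i)
      _ = ∑ σ ∈ Fintype.piFinset (fun _ : Fin m => S₀),
            ∏ i, (Fn (Ψ i Y - σ i * N) + (#S₀ : ℝ)⁻¹) := prod_univ_sum _ _
      _ ≤ _ := by
          refine sum_le_sum fun σ _ => ?_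
          rw [prod_add]
          refine sum_le_sum fun A _ => ?_
          have h1 : ∏ _i ∈ univ \ A, (#S₀ : ℝ)⁻¹ ≤ 1 :=
            prod_le_one (fun _ _ => by positivity) (fun _ _ => inv_le_one_of_one_le₀ hS₀1)
          have h0 : 0 ≤ ∏ i ∈ A, Fn (Ψ i Y - σ i * N) := prod_nonneg fun _ _ => hF0 _
          calc (∏ i ∈ A, Fn (Ψ i Y - σ i * N)) * ∏ _i ∈ univ \ A, (#S₀ : ℝ)⁻¹
              ≤ (∏ i ∈ A, Fn (Ψ i Y - σ i * N)) * 1 := mul_le_mul_of_nonneg_left h1 h0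
            _ = _ := mul_one _
  have hc : (0 : ℝ) ≤ #(box N Q u) := Nat.cast_nonneg _
  calc ∑ Y ∈ box N Q u, ∏ i, νZ (Ψ i Y)
      ≤ ∑ Y ∈ box N Q u, ∑ σ ∈ Fintype.piFinset (fun _ : Fin m => S₀),
          ∑ A ∈ (univ : Finset (Fin m)).powerset, ∏ i ∈ A, Fn (Ψ i Y - σ i * N) := sum_le_sum hpt
    _ = ∑ σ ∈ Fintype.piFinset (fun _ : Fin m => S₀), ∑ A ∈ (univ : Finset (Fin m)).powerset,
          ∑ Y ∈ box N Q u, ∏ i ∈ A, Fn (Ψ i Y - σ i * N) := by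
        rw [sum_comm]
        exact sum_congr rfl fun σ _ => sum_comm
    _ ≤ ∑ _σ ∈ Fintype.piFinset (fun _ : Fin m => S₀), ∑ _A ∈ (univ : Finset (Fin m)).powerset,
          (2 : ℝ) * #(box N Q u) := by
        refine sum_le_sum fun σ _ => sum_le_sum fun A _ => ?_
        have h' := (abs_le.1 (hCORE A σ)).2
        nlinarith
    _ = (#S₀ : ℝ) ^ m * 2 ^ m * 2 * #(box N Q u) := by
        rw [sum_const, sum_const, card_powerset, card_univ, Fintype.card_fin,
          Fintype.card_piFinset, prod_const, card_univ, Fintype.card_fin, smul_smul, nsmul_eq_mul]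
        push_cast
        ring

/-- **Nice boxes** (p. 527): if for every `i` and every shift `s ∈ S₀` the box `B_u` is mapped
by `Ψ_i - sN` entirely inside or entirely outside the window, then on `B_u` each factor
`ν(Ψ_i(Y) mod N)` is either `F(Ψ_i(Y) - s_i N)` (for a shift `s_i` independent of `Y`,
footnote 22) or `1`, and the core estimate gives `|∑_{B_u} ∏_i ν(Ψ_i) - #B_u| ≤ ε' #B_u`.
[cite: GreenTaoAnnals2008, Proposition 9.8 (proof, p. 527 and footnote 22)] -/
theorem box_sum_prod_nice {N Q n m : ℕ} (νZ Fn : ℤ → ℝ) (Ψ : Fin m → (Fin (n + 1) → ℤ) → ℤ)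
    (S₀ : Finset ℤ) {ε₀ ε' : ℝ}
    (hν : ∀ z, νZ z = if InWindow ε₀ N (z % N) then Fn (z % N) else 1)
    (hwr : ∀ r : ℤ, InWindow ε₀ N r → 0 ≤ r ∧ r < N)
    (u : Fin (n + 1) → ℕ) (hΨS₀ : ∀ i, ∀ Y ∈ box N Q u, Ψ i Y / N ∈ S₀)
    (hnice : ∀ i, ∀ s ∈ S₀, (∀ Y ∈ box N Q u, InWindow ε₀ N (Ψ i Y - s * N)) ∨
      (∀ Y ∈ box N Q u, ¬ InWindow ε₀ N (Ψ i Y - s * N)))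
    (hCORE : ∀ (A : Finset (Fin m)) (σ : Fin m → ℤ),
      |∑ Y ∈ box N Q u, ∏ i ∈ A, Fn (Ψ i Y - σ i * N) - #(box N Q u)| ≤ ε' * #(box N Q u)) :
    |∑ Y ∈ box N Q u, ∏ i, νZ (Ψ i Y) - #(box N Q u)| ≤ ε' * #(box N Q u) := by
  classical
  set Au : Finset (Fin m) :=
    univ.filter fun i => ∃ s ∈ S₀, ∀ Y ∈ box N Q u, InWindow ε₀ N (Ψ i Y - s * N) with hAu_def
  have hchoose : ∀ i ∈ Au, ∃ s ∈ S₀, ∀ Y ∈ box N Q u, InWindow ε₀ N (Ψ i Y - s * N) :=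
    fun i hi => (mem_filter.1 hi).2
  choose! sfun _hsS₀ hswin using hchoose
  have hΦ : ∀ Y ∈ box N Q u, ∏ i, νZ (Ψ i Y) = ∏ i ∈ Au, Fn (Ψ i Y - sfun i * N) := by
    intro Y hY
    have hpt : ∀ i, νZ (Ψ i Y) = if i ∈ Au then Fn (Ψ i Y - sfun i * N) else 1 := by
      intro i
      split_ifs with hi
      · have hw := hswin i hi Y hY
        obtain ⟨hr0, hrN⟩ := hwr _ hw
        have hmod : Ψ i Y % N = Ψ i Y - sfun i * N := by
          have h1 : Ψ i Y = (Ψ i Y - sfun i * N) + N * sfun i := by ring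
          conv_lhs => rw [h1]
          rw [Int.add_mul_emod_self_left, Int.emod_eq_of_lt hr0 hrN]
        rw [hν, hmod, if_pos hw]
      · have hs : Ψ i Y / N ∈ S₀ := hΨS₀ i Y hY
        have hr : Ψ i Y % N = Ψ i Y - (Ψ i Y / N) * N := by rw [Int.emod_def]; ring
        rcases hnice i (Ψ i Y / N) hs with hall | hnone
        · exact absurd (mem_filter.2 ⟨mem_univ _, _, hs, hall⟩) hi
        · have := hnone Y hY
          rw [hν, hr, if_neg this]
    rw [prod_congr rfl fun i _ => hpt i, ← prod_filter]
    congr 1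
    ext i
    simp
  rw [sum_congr rfl hΦ]
  exact hCORE Au sfun

/-- **Points of a non-nice box lie near a hyperplane** (p. 528): if `Ψ_i - sN` maps some point
of `B_u` into the window and another outside, then a boundary `aε₀N` (`a ∈ {1,2}`) lies between
the two values, hence every point of the box is within `2·spread` of the hyperplane
`Ψ_i = sN + aε₀N`, where `spread` bounds the oscillation of `Ψ_i` on the box.
[cite: GreenTaoAnnals2008, Proposition 9.8 (proof, p. 528)] -/
theorem exists_near_hyperplane_of_not_nice {N Q n m : ℕ} (Ψ : Fin m → (Fin (n + 1) → ℤ) → ℤ)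
    (S₀ : Finset ℤ) {ε₀ spread : ℝ} (u : Fin (n + 1) → ℕ)
    (hspread : ∀ i, ∀ Y ∈ box N Q u, ∀ Y' ∈ box N Q u, |((Ψ i Y : ℤ) : ℝ) - Ψ i Y'| ≤ spread)
    (hnn : ¬ ∀ i, ∀ s ∈ S₀, (∀ Y ∈ box N Q u, InWindow ε₀ N (Ψ i Y - s * N)) ∨
      (∀ Y ∈ box N Q u, ¬ InWindow ε₀ N (Ψ i Y - s * N))) :
    ∃ i : Fin m, ∃ s ∈ S₀, ∃ a ∈ ({1, 2} : Finset ℕ), ∀ Y ∈ box N Q u,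
      |((Ψ i Y : ℤ) : ℝ) - s * N - a * ε₀ * N| ≤ 2 * spread := by
  simp only [not_forall, not_or, not_not, exists_prop] at hnn
  obtain ⟨i, s, hs, ⟨Y₁, hY₁, hw₁⟩, ⟨Y₂, hY₂, hw₂⟩⟩ := hnn
  set p : ℝ := ((Ψ i Y₂ - s * N : ℤ) : ℝ) with hp
  set q : ℝ := ((Ψ i Y₁ - s * N : ℤ) : ℝ) with hq
  have hwp : ε₀ * N ≤ p ∧ p ≤ 2 * ε₀ * N := hw₂
  have hwq : q < ε₀ * N ∨ 2 * ε₀ * N < q := by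
    simp only [InWindow, not_and_or, not_le] at hw₁
    exact hw₁
  have hpq : |p - q| ≤ spread := by
    simp only [hp, hq]
    push_cast
    rw [show ((Ψ i Y₂ : ℤ) : ℝ) - s * N - ((Ψ i Y₁ : ℝ) - s * N) = (Ψ i Y₂ : ℝ) - Ψ i Y₁ by ring]
    exact hspread i Y₂ hY₂ Y₁ hY₁
  obtain ⟨a, ha, hap⟩ : ∃ a ∈ ({1, 2} : Finset ℕ), |(a : ℝ) * ε₀ * N - p| ≤ |p - q| := by
    rcases hwq with h | h
    · refine ⟨1, by simp, ?_⟩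
      push_cast
      rw [abs_of_nonpos (by linarith), abs_of_nonneg (by linarith)]
      linarith
    · refine ⟨2, by simp, ?_⟩
      push_cast
      rw [abs_of_nonneg (by linarith), abs_of_nonpos (by linarith)]
      linarith
  refine ⟨i, s, hs, a, ha, fun Y hY => ?_⟩
  have h3 : |((Ψ i Y : ℤ) : ℝ) - Ψ i Y₂| ≤ spread := hspread i Y hY Y₂ hY₂
  calc |((Ψ i Y : ℤ) : ℝ) - s * N - a * ε₀ * N|
      = |(((Ψ i Y : ℤ) : ℝ) - Ψ i Y₂) + (p - a * ε₀ * N)| := by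
        congr 1; simp only [hp]; push_cast; ring
    _ ≤ |((Ψ i Y : ℤ) : ℝ) - Ψ i Y₂| + |p - a * ε₀ * N| := abs_add_le _ _
    _ ≤ spread + spread := add_le_add h3 (by rw [abs_sub_comm]; exact hap.trans hpq)
    _ = 2 * spread := by ring

/-- The oscillation of an integer form `Ψ_i(Y) = ∑_j L'_{ij} Y_j + b̃_i`, `|L'_{ij}| ≤ Λ`, on a
box with sides `≤ S` is at most `t Λ S` (p. 528: "`ψ_i(x) = ∑_j L_{ij} N u_j/Q + b_i + O(N/Q)`").
[cite: GreenTaoAnnals2008, Proposition 9.8 (proof, p. 528)] -/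
theorem abs_linearForm_sub_le {N Q n m : ℕ} {Λ S : ℝ} (L' : Fin m → Fin (n + 1) → ℤ)
    (hL'bd : ∀ i j, (|L' i j| : ℝ) ≤ Λ) (B : Fin m → ℤ) (hside : ∀ v, (boxSide N Q v : ℝ) ≤ S)
    (u : Fin (n + 1) → ℕ) (i : Fin m) {Y Y' : Fin (n + 1) → ℤ} (hY : Y ∈ box N Q u)
    (hY' : Y' ∈ box N Q u) :
    |((∑ j, L' i j * Y j + B i : ℤ) : ℝ) - (∑ j, L' i j * Y' j + B i : ℤ)| ≤
      ((n + 1 : ℕ) : ℝ) * Λ * S := by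
  have hΛ : 0 ≤ Λ := le_trans (by positivity) (hL'bd i 0)
  have hYY : ∀ j, |((Y j : ℤ) : ℝ) - Y' j| ≤ S := by
    intro j
    have h1 := (mem_box_iff.1 hY) j
    have h2 := (mem_box_iff.1 hY') j
    have hs := boxLo_add_boxSide N Q (u j)
    have h3 : |Y j - Y' j| ≤ boxSide N Q (u j) := by
      rw [abs_le]; constructor <;> linarith
    have h4 : |((Y j : ℤ) : ℝ) - Y' j| ≤ boxSide N Q (u j) := by exact_mod_cast h3
    exact h4.trans (hside (u j))
  push_cast
  rw [show (∑ j, (L' i j : ℝ) * Y j + B i) - (∑ j, (L' i j : ℝ) * Y' j + B i) =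
    ∑ j, (L' i j : ℝ) * (Y j - Y' j) by simp only [mul_sub, sum_sub_distrib]; ring]
  calc |∑ j, (L' i j : ℝ) * (Y j - Y' j)| ≤ ∑ j, |(L' i j : ℝ) * (Y j - Y' j)| :=
        abs_sum_le_sum_abs _ _
    _ ≤ ∑ _j : Fin (n + 1), Λ * S := by
        refine sum_le_sum fun j _ => ?_
        rw [abs_mul]
        exact mul_le_mul (hL'bd i j) (hYY j) (abs_nonneg _) hΛ
    _ = _ := by
        rw [sum_const, card_univ, Fintype.card_fin, nsmul_eq_mul]; push_cast; ring

/-- **Total volume of the boxes covered by "bad" sets** (p. 528, in volume form): if every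
box `B_u`, `u ∈ U'`, is contained in one of the sets `Bad(w)`, `w ∈ Wit`, each of size `≤ K`,
then `∑_{u ∈ U'} #B_u ≤ #Wit · K` (distinct boxes being disjoint).
[cite: GreenTaoAnnals2008, Proposition 9.8 (proof, p. 528)] -/
theorem sum_card_box_le {N Q t : ℕ} {ι : Type*} (U' : Finset (Fin t → ℕ)) (Wit : Finset ι)
    (Bad : ι → Finset (Fin t → ℤ)) (hNN : ∀ u ∈ U', ∃ w ∈ Wit, box N Q u ⊆ Bad w) {K : ℝ}
    (hBad : ∀ w ∈ Wit, (#(Bad w) : ℝ) ≤ K) :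
    ∑ u ∈ U', (#(box N Q u) : ℝ) ≤ #Wit * K := by
  classical
  have hstep1 : ∑ u ∈ U', (#(box N Q u) : ℝ) ≤
      ∑ u ∈ U', ∑ w ∈ Wit, (if box N Q u ⊆ Bad w then (#(box N Q u) : ℝ) else 0) := by
    refine sum_le_sum fun u hu => ?_
    obtain ⟨w, hw, hsub⟩ := hNN u hu
    calc (#(box N Q u) : ℝ) = if box N Q u ⊆ Bad w then (#(box N Q u) : ℝ) else 0 := by
          rw [if_pos hsub]
      _ ≤ ∑ w ∈ Wit, (if box N Q u ⊆ Bad w then (#(box N Q u) : ℝ) else 0) :=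
          single_le_sum (f := fun w => if box N Q u ⊆ Bad w then (#(box N Q u) : ℝ) else 0)
            (fun w _ => by positivity) hw
  have hstep2 : ∀ w ∈ Wit,
      ∑ u ∈ U', (if box N Q u ⊆ Bad w then (#(box N Q u) : ℝ) else 0) ≤ #(Bad w) := by
    intro w _
    rw [← sum_filter]
    have hdisj : ((U'.filter fun u => box N Q u ⊆ Bad w) : Set (Fin t → ℕ)).PairwiseDisjoint
        (box N Q) := fun u _ u' _ huu' => box_disjoint huu'
    have hU : (U'.filter fun u => box N Q u ⊆ Bad w).biUnion (box N Q) ⊆ Bad w := by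
      intro Y hY
      obtain ⟨u, hu, hYu⟩ := mem_biUnion.1 hY
      exact (mem_filter.1 hu).2 hYu
    calc ∑ u ∈ U'.filter (fun u => box N Q u ⊆ Bad w), (#(box N Q u) : ℝ)
        = #((U'.filter fun u => box N Q u ⊆ Bad w).biUnion (box N Q)) := by
          rw [card_biUnion hdisj]; push_cast; rfl
      _ ≤ #(Bad w) := by exact_mod_cast card_le_card hU
  calc ∑ u ∈ U', (#(box N Q u) : ℝ)
      ≤ ∑ u ∈ U', ∑ w ∈ Wit, (if box N Q u ⊆ Bad w then (#(box N Q u) : ℝ) else 0) := hstep1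
    _ = ∑ w ∈ Wit, ∑ u ∈ U', (if box N Q u ⊆ Bad w then (#(box N Q u) : ℝ) else 0) := sum_comm
    _ ≤ ∑ w ∈ Wit, (#(Bad w) : ℝ) := sum_le_sum hstep2
    _ ≤ ∑ _w ∈ Wit, K := sum_le_sum hBad
    _ = #Wit * K := by rw [sum_const, nsmul_eq_mul]


/-! ### Proposition 9.8 in generic form -/

set_option maxHeartbeats 400000 in
/-- **Green–Tao 2008, Proposition 9.8, in generic form.** Let `ν_N(x) = F_N(x)` for
`x ∈ [ε₀ N, 2ε₀ N]` and `ν_N(x) = 1` otherwise (`x ∈ ℤ_N` read in `[0, N)`, `0 < ε₀`, `2ε₀ < 1`),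
with `F_N ≥ 0` obeying the Goldston–Yıldırım type linear forms asymptotic of Proposition 9.5 in
the normalised form: for `1 ≤ m ≤ m₀`, `1 ≤ t ≤ t₀`, integer matrices `|L_{ij}| ≤ L₀ · L₀!`
with nonzero, pairwise non-proportional rows, all `b ∈ ℤ^m` and all boxes `∏_j [a_j, a_j + ℓ_j)`
with `ℓ_j ≥ θ(N)`, `E(∏_i F_N(ψ_i(x)) | x ∈ box) = 1 + o(1)` uniformly, where `θ(N) = o(N)`.
Then `ν` satisfies the `(m₀, t₀, L₀)`-linear forms condition (Definition 3.1). This is the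
argument printed on pp. 526–528: clear denominators (`x = L₀! · y`, a bijection of `ℤ_N^t` for
`N > L₀` prime; the new coefficients are integers of size `≤ L₀ · L₀!`), chop `ℤ_N^t = [0,N)^t`
into `Q^t` boxes, evaluate nice boxes by the asymptotic (footnote 22: the multiple of `N` to
subtract from `ψ_i` is constant on the box and is absorbed into `b_i`), bound non-nice boxes by
`O(1)` using `ν ≤ 1 + ∑_s F_N(ψ_i - sN)` and the asymptotic again, and show that the non-nice
boxes have total volume `O(N^t/Q)` (a point of a non-nice box lies within `O(N/Q)` of one of the
hyperplanes `ψ_i = sN + aε₀N`, `a ∈ {1, 2}`, `|s| = O(1)`); here `Q` is a large constant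
depending on `ε` rather than a slowly growing function.
[cite: GreenTaoAnnals2008, Proposition 9.8 (proof, pp. 526–528)] -/
theorem linearFormsCondition_of_boxAsymptotic {m₀ t₀ L₀ : ℕ} {ν : (N : ℕ) → ZMod N → ℝ}
    (F : ℕ → ℤ → ℝ) {ε₀ : ℝ} (hε₀ : 0 < ε₀) (hε₁ : 2 * ε₀ < 1)
    (hν : ∀ N (x : ZMod N), ν N x = if InWindow ε₀ N x.val then F N x.val else 1)
    (hF0 : ∀ N n, 0 ≤ F N n)
    (θ : ℕ → ℝ) (hθ : Tendsto (fun N => θ N / N) atTop (𝓝 0))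
    (HLF : ∀ m t, 1 ≤ m → m ≤ m₀ → 1 ≤ t → t ≤ t₀ → ∀ ε : ℝ, 0 < ε → ∀ᶠ N : ℕ in atTop,
      N.Prime → ∀ L : Fin m → Fin t → ℤ, (∀ i j, |L i j| ≤ L₀ * L₀.factorial) → (∀ i, L i ≠ 0) →
        (∀ i i', i ≠ i' → ∀ c : ℚ, (fun j => (L i j : ℚ)) ≠ c • fun j => (L i' j : ℚ)) →
        ∀ b : Fin m → ℤ, ∀ a : Fin t → ℤ, ∀ ℓ : Fin t → ℕ, (∀ j, θ N ≤ ℓ j) →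
          |(𝔼 x ∈ Fintype.piFinset fun j => Ico (a j) (a j + ℓ j),
              ∏ i, F N (∑ j, L i j * x j + b i)) - 1| ≤ ε) :
    LinearFormsCondition m₀ t₀ L₀ ν := by
  classical
  intro m t hm ht L hL hL0 hLp ε hε
  ------------------------------------------------------------------ trivial cases
  rcases Nat.eq_zero_or_pos m with rfl | hm1
  · refine Filter.Eventually.of_forall fun N _ b => ?_
    have : ∀ x : Fin t → ZMod N,
        ∏ i : Fin 0, ν N (∑ j, ((L i j : ℚ) : ZMod N) * x j + b i) = 1 := fun x =>
      Fintype.prod_empty _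
    simp_rw [this]
    rw [expect_const univ_nonempty, sub_self, abs_zero]
    exact hε.le
  rcases Nat.eq_zero_or_pos t with rfl | ht1
  · exact absurd (funext fun j => Fin.elim0 j) (hL0 ⟨0, hm1⟩)
  obtain ⟨n, rfl⟩ : ∃ n, t = n + 1 := ⟨t - 1, by omega⟩
  ------------------------------------------------------------------ the integer matrix
  set L' : Fin m → Fin (n + 1) → ℤ := intMatrix L₀ L with hL'_def
  have hL'bd : ∀ i j, |L' i j| ≤ L₀ * L₀.factorial := abs_intMatrix_le hL
  have hL'0 : ∀ i, L' i ≠ 0 := intMatrix_ne_zero hL hL0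
  have hL'p : ∀ i i', i ≠ i' → ∀ c : ℚ, (fun j => (L' i j : ℚ)) ≠ c • fun j => (L' i' j : ℚ) :=
    intMatrix_not_prop hL hLp
  ------------------------------------------------------------------ constants
  set ε' : ℝ := min (ε / 2) 1 with hε'_def
  have hε'0 : 0 < ε' := lt_min (by linarith) one_pos
  have hε'1 : ε' ≤ 1 := min_le_right _ _
  have hε'ε : ε' ≤ ε / 2 := min_le_left _ _
  set Lmax : ℕ := L₀ * L₀.factorial with hLmax_def
  set Z : ℕ := (n + 1) * Lmax + 2 with hZ_def
  set S₀ : Finset ℤ := Icc (-(Z : ℤ)) Z with hS₀_def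
  have hS₀ne : S₀.Nonempty := ⟨0, by simp [hS₀_def]⟩
  have hS₀card : (#S₀ : ℝ) = 2 * Z + 1 := by
    rw [hS₀_def, Int.card_Icc]
    rw [show ((Z : ℤ) + 1 - -(Z : ℤ)) = ((2 * Z + 1 : ℕ) : ℤ) by push_cast; ring, Int.toNat_natCast]
    push_cast; ring
  have hS₀pos : (0 : ℝ) < #S₀ := by rw [hS₀card]; positivity
  set K₁ : ℝ := (#S₀ : ℝ) ^ m * 2 ^ m * 2 with hK₁_def
  have hK₁0 : 0 ≤ K₁ := by positivity
  set K₂ : ℝ := (m : ℝ) * (#S₀ * 2) * (8 * (((n + 1 : ℕ) : ℝ) * Lmax) + 1) with hK₂_def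
  have hK₂0 : 0 ≤ K₂ := by positivity
  set Q : ℕ := ⌈2 * ((K₁ + 1) * K₂) / ε⌉₊ + 1 with hQ_def
  have hQ0 : 0 < Q := Nat.succ_pos _
  have hQR : (0 : ℝ) < Q := by exact_mod_cast hQ0
  have hQε : (K₁ + 1) * K₂ / Q ≤ ε / 2 := by
    rw [div_le_iff₀ hQR]
    have h1 : 2 * ((K₁ + 1) * K₂) / ε ≤ Q := by
      calc 2 * ((K₁ + 1) * K₂) / ε ≤ ⌈2 * ((K₁ + 1) * K₂) / ε⌉₊ := Nat.le_ceil _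
        _ ≤ Q := by exact_mod_cast Nat.le_succ _
    rw [div_le_iff₀ hε] at h1
    linarith
  ------------------------------------------------------------------ eventualities
  have E1 : ∀ᶠ N : ℕ in atTop, ∀ m' ∈ Icc 1 m, N.Prime → ∀ L'' : Fin m' → Fin (n + 1) → ℤ,
      (∀ i j, |L'' i j| ≤ L₀ * L₀.factorial) → (∀ i, L'' i ≠ 0) →
        (∀ i i', i ≠ i' → ∀ c : ℚ, (fun j => (L'' i j : ℚ)) ≠ c • fun j => (L'' i' j : ℚ)) →
        ∀ b'' : Fin m' → ℤ, ∀ a : Fin (n + 1) → ℤ, ∀ ℓ : Fin (n + 1) → ℕ, (∀ j, θ N ≤ ℓ j) →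
          |(𝔼 x ∈ Fintype.piFinset fun j => Ico (a j) (a j + ℓ j),
              ∏ i, F N (∑ j, L'' i j * x j + b'' i)) - 1| ≤ ε' :=
    (Filter.eventually_all_finset (Icc 1 m)).2 fun m' hm' =>
      HLF m' (n + 1) (mem_Icc.1 hm').1 ((mem_Icc.1 hm').2.trans hm) ht1 ht ε' hε'0
  have E2 : ∀ᶠ N : ℕ in atTop, θ N ≤ (N : ℝ) / Q - 1 := by
    have h1 : ∀ᶠ N : ℕ in atTop, θ N / N < 1 / (2 * Q) :=
      hθ.eventually (Iio_mem_nhds (by positivity))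
    filter_upwards [h1, eventually_ge_atTop (2 * Q)] with N hN hN2
    have hN2' : (2 * Q : ℝ) ≤ N := by exact_mod_cast hN2
    have hN0 : (0 : ℝ) < N := by linarith
    rw [div_lt_iff₀ hN0] at hN
    have h2 : 1 / (2 * Q) * (N : ℝ) = N / Q / 2 := by field_simp
    have h3 : (1 : ℝ) ≤ N / Q / 2 := by
      rw [le_div_iff₀ two_pos, le_div_iff₀ hQR]; linarith
    linarith
  filter_upwards [E1, E2, eventually_gt_atTop L₀, eventually_ge_atTop (2 * Q)]
    with N hE1 hE2 hL₀N hN2Q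
  intro hprime b
  have hNp := hprime.out
  have hN0 : 0 < N := hNp.pos
  have hN0R : (0 : ℝ) < N := by exact_mod_cast hN0
  have hN0Z : (0 : ℤ) < N := by exact_mod_cast hN0
  have hQN : Q ≤ N := by omega
  ------------------------------------------------------------------ the objects at level N
  set B : Fin m → ℤ := fun i => ((b i).val : ℤ) with hB_def
  have hB : ∀ i, 0 ≤ B i ∧ B i < N := fun i =>
    ⟨by positivity, by change ((b i).val : ℤ) < N; exact_mod_cast ZMod.val_lt (b i)⟩
  set Ψ : Fin m → (Fin (n + 1) → ℤ) → ℤ := fun i Y => ∑ j, L' i j * Y j + B i with hΨ_def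
  set νZ : ℤ → ℝ := fun z => ν N ((z : ℤ) : ZMod N) with hνZ_def
  set SY := Fintype.piFinset fun _ : Fin (n + 1) => Ico (0 : ℤ) N with hSY_def
  set U := Fintype.piFinset fun _ : Fin (n + 1) => range Q with hU_def
  have hUQ : ∀ u ∈ U, ∀ j, u j < Q := fun u hu j => mem_range.1 (Fintype.mem_piFinset.1 hu j)
  -- `ν` of an integer
  have hνZ : ∀ z : ℤ, νZ z = if InWindow ε₀ N (z % N) then F N (z % N) else 1 := by
    intro z
    simp only [hνZ_def]
    rw [hν]
    have hv : ((((z : ℤ) : ZMod N)).val : ℤ) = z % N := ZMod.val_intCast z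
    rw [hv]
  have hν0 : ∀ z, 0 ≤ νZ z := by
    intro z; rw [hνZ]; split_ifs; exacts [hF0 _ _, zero_le_one]
  have hwr : ∀ r : ℤ, InWindow ε₀ N r → 0 ≤ r ∧ r < N := by
    intro r ⟨h1, h2⟩
    constructor
    · have : (0 : ℝ) ≤ r := le_trans (by positivity) h1
      exact_mod_cast this
    · have : (r : ℝ) < N := by nlinarith
      exact_mod_cast this
  -- sizes of Ψ
  have hΨbd : ∀ i, ∀ Y ∈ SY, |Ψ i Y| < (((n + 1) * Lmax + 1 : ℕ) : ℤ) * N := by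
    intro i Y hY
    have hYj : ∀ j, 0 ≤ Y j ∧ Y j < N := fun j => by
      have := mem_Ico.1 (Fintype.mem_piFinset.1 hY j); exact ⟨this.1, this.2⟩
    simp only [hΨ_def]
    calc |∑ j, L' i j * Y j + B i| ≤ |∑ j, L' i j * Y j| + |B i| := abs_add_le _ _
      _ ≤ (∑ j, |L' i j * Y j|) + |B i| := by gcongr; exact abs_sum_le_sum_abs _ _
      _ ≤ (∑ _j : Fin (n + 1), (Lmax : ℤ) * N) + |B i| := by
          gcongr with j
          rw [abs_mul]
          exact mul_le_mul (by exact_mod_cast hL'bd i j)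
            (abs_le.2 ⟨by linarith [(hYj j).1], (hYj j).2.le⟩) (abs_nonneg _) (by positivity)
      _ = ((n + 1 : ℕ) : ℤ) * (Lmax * N) + |B i| := by
          rw [sum_const, card_univ, Fintype.card_fin, nsmul_eq_mul]
      _ < ((n + 1 : ℕ) : ℤ) * (Lmax * N) + N := by
          gcongr
          rw [abs_of_nonneg (hB i).1]; exact (hB i).2
      _ = (((n + 1) * Lmax + 1 : ℕ) : ℤ) * N := by push_cast; ring
  have hΨS₀ : ∀ i, ∀ Y ∈ SY, Ψ i Y / N ∈ S₀ := by
    intro i Y hY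
    have h := abs_lt.1 (hΨbd i Y hY)
    rw [hS₀_def, mem_Icc]
    have hZ : (((n + 1) * Lmax + 1 : ℕ) : ℤ) + 1 ≤ Z := by simp only [hZ_def]; push_cast; omega
    constructor
    · have : -((((n + 1) * Lmax + 1 : ℕ) : ℤ)) ≤ Ψ i Y / N :=
        (Int.le_ediv_iff_mul_le hN0Z).2 (by linarith)
      linarith
    · have : Ψ i Y / N < (((n + 1) * Lmax + 1 : ℕ) : ℤ) :=
        (Int.ediv_lt_iff_lt_mul hN0Z).2 (by linarith)
      linarith
  -- box sizes
  have hside : ∀ v, θ N ≤ boxSide N Q v ∧ (1 : ℝ) ≤ boxSide N Q v ∧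
      (boxSide N Q v : ℝ) ≤ 2 * N / Q := by
    intro v
    obtain ⟨h1, h2⟩ := boxSide_bounds (N := N) hQ0 v
    have hNQ : (2 : ℝ) ≤ (N : ℝ) / Q := by
      rw [le_div_iff₀ hQR]; exact_mod_cast hN2Q
    refine ⟨hE2.trans h1, by linarith, ?_⟩
    calc (boxSide N Q v : ℝ) ≤ N / Q + 1 := h2
      _ ≤ N / Q + N / Q := by linarith
      _ = 2 * N / Q := by ring
  have hboxpos : ∀ u : Fin (n + 1) → ℕ, 0 < #(box N Q u) := by
    intro u
    rw [card_box]
    exact prod_pos fun j _ => by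
      have := (hside (u j)).2.1
      exact_mod_cast (show (0 : ℝ) < boxSide N Q (u j) by linarith)
  have hboxposR : ∀ u : Fin (n + 1) → ℕ, (0 : ℝ) < #(box N Q u) := fun u => by
    exact_mod_cast hboxpos u
  ------------------------------------------------------------------ the box-level steps
  have CORE : ∀ (u : Fin (n + 1) → ℕ) (A : Finset (Fin m)) (σ : Fin m → ℤ),
      |∑ Y ∈ box N Q u, ∏ i ∈ A, F N (Ψ i Y - σ i * N) - #(box N Q u)| ≤ ε' * #(box N Q u) :=
    fun u A σ => box_linearForms_core (F N) L' hL'bd hL'0 hL'p B (fun m' hm' => hE1 m' hm' hNp)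
      (fun v => (hside v).1) hboxpos hε'0.le u A σ
  have hνle : ∀ u ∈ U, ∀ Y ∈ box N Q u, ∀ i,
      νZ (Ψ i Y) ≤ ∑ s ∈ S₀, (F N (Ψ i Y - s * N) + (#S₀ : ℝ)⁻¹) := by
    intro u hu Y hY i
    have hs : Ψ i Y / N ∈ S₀ := hΨS₀ i Y (box_subset hQ0 (hUQ u hu) hY)
    have hr : Ψ i Y % N = Ψ i Y - (Ψ i Y / N) * N := by rw [Int.emod_def]; ring
    rw [sum_add_distrib, sum_const, nsmul_eq_mul, mul_inv_cancel₀ hS₀pos.ne']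
    have hsum0 : 0 ≤ ∑ s ∈ S₀, F N (Ψ i Y - s * N) := sum_nonneg fun _ _ => hF0 _ _
    rw [hνZ]
    split_ifs with hw
    · calc F N (Ψ i Y % N) = F N (Ψ i Y - (Ψ i Y / N) * N) := by rw [hr]
        _ ≤ ∑ s ∈ S₀, F N (Ψ i Y - s * N) :=
            single_le_sum (f := fun s => F N (Ψ i Y - s * N)) (fun _ _ => hF0 _ _) hs
        _ ≤ _ := by linarith only [hsum0]
    · linarith only [hsum0]
  have UPPER : ∀ u ∈ U, ∑ Y ∈ box N Q u, ∏ i, νZ (Ψ i Y) ≤ K₁ * #(box N Q u) :=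
    fun u hu => box_sum_prod_le νZ (F N) Ψ S₀ hS₀ne hν0 (hF0 N) u (hνle u hu) (CORE u) hε'1
  set nice : (Fin (n + 1) → ℕ) → Prop := fun u => ∀ i, ∀ s ∈ S₀,
    (∀ Y ∈ box N Q u, InWindow ε₀ N (Ψ i Y - s * N)) ∨
      (∀ Y ∈ box N Q u, ¬ InWindow ε₀ N (Ψ i Y - s * N)) with hnice_def
  have NICE : ∀ u ∈ U, nice u →
      |∑ Y ∈ box N Q u, ∏ i, νZ (Ψ i Y) - #(box N Q u)| ≤ ε' * #(box N Q u) :=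
    fun u hu hnu => box_sum_prod_nice νZ (F N) Ψ S₀ hνZ hwr u
      (fun i Y hY => hΨS₀ i Y (box_subset hQ0 (hUQ u hu) hY)) hnu (CORE u)
  -- non-nice boxes: volume
  set spread : ℝ := ((n + 1 : ℕ) : ℝ) * Lmax * (2 * N / Q) with hspread_def
  have hspread0 : 0 ≤ spread := by positivity
  have hspread : ∀ u : Fin (n + 1) → ℕ, ∀ i, ∀ Y ∈ box N Q u, ∀ Y' ∈ box N Q u,
      |((Ψ i Y : ℤ) : ℝ) - Ψ i Y'| ≤ spread :=
    fun u i Y hY Y' hY' => abs_linearForm_sub_le L'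
      (fun i j => by rw [← Int.cast_abs]; exact_mod_cast hL'bd i j) B
      (fun v => (hside v).2.2) u i hY hY'
  set Wit : Finset (Fin m × ℤ × ℕ) := univ ×ˢ (S₀ ×ˢ ({1, 2} : Finset ℕ)) with hWit_def
  have hWitcard : (#Wit : ℝ) = m * (#S₀ * 2) := by
    rw [hWit_def, card_product, card_product, card_univ, Fintype.card_fin,
      card_pair (by norm_num)]
    push_cast; ring
  set BadY : Fin m × ℤ × ℕ → Finset (Fin (n + 1) → ℤ) := fun w =>
    SY.filter fun Y => |((Ψ w.1 Y : ℤ) : ℝ) - w.2.1 * N - w.2.2 * ε₀ * N| ≤ 2 * spread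
    with hBadY_def
  have hBadY : ∀ w ∈ Wit, (#(BadY w) : ℝ) ≤ (4 * spread + 1) * (N : ℝ) ^ n := by
    intro w _
    obtain ⟨j₀, hj₀⟩ : ∃ j₀, L' w.1 j₀ ≠ 0 := by
      by_contra h
      push Not at h
      exact hL'0 w.1 (funext h)
    have h := card_filter_linearForm_le (N := N) j₀ (L' w.1) hj₀
      ((B w.1 : ℝ) - w.2.1 * N - w.2.2 * ε₀ * N) (ρ := 2 * spread) (by positivity)
    have heq : BadY w = SY.filter (fun Y => |(∑ j, (L' w.1 j : ℝ) * Y j) +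
        ((B w.1 : ℝ) - w.2.1 * N - w.2.2 * ε₀ * N)| ≤ 2 * spread) := by
      simp only [hBadY_def]
      refine filter_congr fun Y _ => ?_
      simp only [hΨ_def]
      push_cast
      rw [show (∑ j, (L' w.1 j : ℝ) * Y j + B w.1) - w.2.1 * N - w.2.2 * ε₀ * N =
        (∑ j, (L' w.1 j : ℝ) * Y j) + ((B w.1 : ℝ) - w.2.1 * N - w.2.2 * ε₀ * N) by ring]
    rw [heq]
    calc _ ≤ (2 * (2 * spread) + 1) * (N : ℝ) ^ n := h
      _ = (4 * spread + 1) * (N : ℝ) ^ n := by ring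
  have hNN : ∀ u ∈ U.filter (fun u => ¬ nice u), ∃ w ∈ Wit, box N Q u ⊆ BadY w := by
    intro u hu
    obtain ⟨hu', hnn⟩ := mem_filter.1 hu
    obtain ⟨i, s, hs, a, ha, hY⟩ :=
      exists_near_hyperplane_of_not_nice Ψ S₀ u (hspread u) hnn
    refine ⟨(i, s, a), ?_, fun Y hYb => mem_filter.2 ⟨box_subset hQ0 (hUQ u hu') hYb, hY Y hYb⟩⟩
    simp only [hWit_def, mem_product, mem_univ, true_and]
    exact ⟨hs, ha⟩
  have VOL : ∑ u ∈ U.filter (fun u => ¬ nice u), (#(box N Q u) : ℝ) ≤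
      #Wit * ((4 * spread + 1) * (N : ℝ) ^ n) :=
    sum_card_box_le _ Wit BadY hNN hBadY
  ------------------------------------------------------------------ assembly
  have hE : 𝔼 x : Fin (n + 1) → ZMod N, ∏ i, ν N (∑ j, ((L i j : ℚ) : ZMod N) * x j + b i) =
      (∑ Y ∈ SY, ∏ i, νZ (Ψ i Y)) / (N : ℝ) ^ (n + 1) := by
    rw [expect_eq_sum_div_card, sum_linearForms_eq_sum_Ico (ν N) hL hL₀N b, card_univ,
      Fintype.card_fun, ZMod.card, Fintype.card_fin]
    push_cast
    congr 1
    refine sum_congr rfl fun Y _ => prod_congr rfl fun i _ => ?_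
    simp only [hνZ_def, hΨ_def, hB_def, hL'_def]
    push_cast
    rfl
  rw [hE]
  have hNt : (0 : ℝ) < (N : ℝ) ^ (n + 1) := by positivity
  have hP1 : ∑ Y ∈ SY, ∏ i, νZ (Ψ i Y) = ∑ u ∈ U, ∑ Y ∈ box N Q u, ∏ i, νZ (Ψ i Y) :=
    sum_eq_sum_boxes hN0 hQ0 _
  have hP2 : (N : ℝ) ^ (n + 1) = ∑ u ∈ U, (#(box N Q u) : ℝ) := by
    have h := sum_eq_sum_boxes (t := n + 1) (N := N) hN0 hQ0 (fun _ => (1 : ℝ))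
    simp only [sum_const, nsmul_eq_mul, mul_one] at h
    rw [← h, Fintype.card_piFinset, prod_const, card_univ, Fintype.card_fin, Int.card_Ico, sub_zero,
      Int.toNat_natCast, Nat.cast_pow]
  have hdiff : |∑ Y ∈ SY, ∏ i, νZ (Ψ i Y) - (N : ℝ) ^ (n + 1)| ≤
      ε' * (N : ℝ) ^ (n + 1) + (K₁ + 1) * (#Wit * ((4 * spread + 1) * (N : ℝ) ^ n)) := by
    rw [hP1]
    nth_rewrite 1 [hP2]
    rw [← sum_sub_distrib]
    refine (abs_sum_le_sum_abs _ _).trans ?_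
    rw [← sum_filter_add_sum_filter_not U nice]
    have hA : ∑ u ∈ U.filter nice, |∑ Y ∈ box N Q u, ∏ i, νZ (Ψ i Y) - #(box N Q u)| ≤
        ε' * (N : ℝ) ^ (n + 1) := by
      calc ∑ u ∈ U.filter nice, |∑ Y ∈ box N Q u, ∏ i, νZ (Ψ i Y) - #(box N Q u)|
          ≤ ∑ u ∈ U.filter nice, ε' * #(box N Q u) :=
            sum_le_sum fun u hu => NICE u (mem_filter.1 hu).1 (mem_filter.1 hu).2
        _ ≤ ∑ u ∈ U, ε' * #(box N Q u) :=
            sum_le_sum_of_subset_of_nonneg (filter_subset _ _) fun u _ _ =>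
              mul_nonneg hε'0.le (Nat.cast_nonneg _)
        _ = ε' * (N : ℝ) ^ (n + 1) := by rw [← mul_sum, ← hP2]
    have hB' : ∑ u ∈ U.filter (fun u => ¬ nice u),
        |∑ Y ∈ box N Q u, ∏ i, νZ (Ψ i Y) - #(box N Q u)| ≤
          (K₁ + 1) * (#Wit * ((4 * spread + 1) * (N : ℝ) ^ n)) := by
      calc ∑ u ∈ U.filter (fun u => ¬ nice u), |∑ Y ∈ box N Q u, ∏ i, νZ (Ψ i Y) - #(box N Q u)|
          ≤ ∑ u ∈ U.filter (fun u => ¬ nice u), (K₁ + 1) * #(box N Q u) := by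
            refine sum_le_sum fun u hu => ?_
            have hu' := (mem_filter.1 hu).1
            have h1 := UPPER u hu'
            have h0 : 0 ≤ ∑ Y ∈ box N Q u, ∏ i, νZ (Ψ i Y) :=
              sum_nonneg fun Y _ => prod_nonneg fun i _ => hν0 _
            have hc := hboxposR u
            have hKc : 0 ≤ K₁ * #(box N Q u) := mul_nonneg hK₁0 hc.le
            rw [abs_le]
            constructor <;> linarith only [h1, h0, hc, hKc]
        _ = (K₁ + 1) * ∑ u ∈ U.filter (fun u => ¬ nice u), (#(box N Q u) : ℝ) := by rw [mul_sum]
        _ ≤ (K₁ + 1) * (#Wit * ((4 * spread + 1) * (N : ℝ) ^ n)) :=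
            mul_le_mul_of_nonneg_left VOL (by linarith only [hK₁0])
    exact add_le_add hA hB'
  have hfinal : (K₁ + 1) * (#Wit * ((4 * spread + 1) * (N : ℝ) ^ n)) ≤
      ε / 2 * (N : ℝ) ^ (n + 1) := by
    have hNQ : (1 : ℝ) ≤ N / Q := by
      rw [le_div_iff₀ hQR, one_mul]; exact_mod_cast hQN
    have h1 : 4 * spread + 1 ≤ (8 * (((n + 1 : ℕ) : ℝ) * Lmax) + 1) * (N / Q) := by
      have h2 : 4 * spread = 8 * (((n + 1 : ℕ) : ℝ) * Lmax) * (N / Q) := by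
        simp only [hspread_def]; ring
      have h3 : (8 * (((n + 1 : ℕ) : ℝ) * Lmax) + 1) * (N / Q) =
          8 * (((n + 1 : ℕ) : ℝ) * Lmax) * (N / Q) + N / Q := by ring
      rw [h2, h3]
      linarith only [hNQ]
    have hNn : (0 : ℝ) ≤ (N : ℝ) ^ n := by positivity
    calc (K₁ + 1) * (#Wit * ((4 * spread + 1) * (N : ℝ) ^ n))
        ≤ (K₁ + 1) * (#Wit * ((8 * (((n + 1 : ℕ) : ℝ) * Lmax) + 1) * (N / Q) * (N : ℝ) ^ n)) :=
          mul_le_mul_of_nonneg_left (mul_le_mul_of_nonneg_left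
            (mul_le_mul_of_nonneg_right h1 hNn) (Nat.cast_nonneg _)) (by linarith only [hK₁0])
      _ = (K₁ + 1) * K₂ / Q * (N : ℝ) ^ (n + 1) := by
          rw [hWitcard, hK₂_def, pow_succ, div_eq_mul_inv, div_eq_mul_inv]
          ring
      _ ≤ ε / 2 * (N : ℝ) ^ (n + 1) := mul_le_mul_of_nonneg_right hQε hNt.le
  rw [div_sub_one hNt.ne', abs_div, abs_of_pos hNt, div_le_iff₀ hNt]
  calc |∑ Y ∈ SY, ∏ i, νZ (Ψ i Y) - (N : ℝ) ^ (n + 1)|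
      ≤ ε' * (N : ℝ) ^ (n + 1) + (K₁ + 1) * (#Wit * ((4 * spread + 1) * (N : ℝ) ^ n)) := hdiff
    _ ≤ ε / 2 * (N : ℝ) ^ (n + 1) + ε / 2 * (N : ℝ) ^ (n + 1) :=
        add_le_add (mul_le_mul_of_nonneg_right hε'ε hNt.le) hfinal
    _ = ε * (N : ℝ) ^ (n + 1) := by ring


/-! ### Proposition 9.8 for the measure of Definition 9.3, from Proposition 9.5 -/

/-- `(R^{10 m₀})/N → 0` for `m₀ = k 2^{k-1}`: `R^{10 k 2^{k-1}} = N^{5/16}` (`k ≥ 1`).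
[cite: GreenTaoAnnals2008, Proposition 9.8 (proof: "`N/Q` will exceed `R^{10m}`")] -/
theorem tendsto_gyLevel_pow_div_atTop {k : ℕ} (hk : 1 ≤ k) :
    Tendsto (fun N : ℕ => gyLevel k N ^ (10 * (k * 2 ^ (k - 1))) / N) atTop (𝓝 0) := by
  have hexp : (k : ℝ)⁻¹ * 2⁻¹ ^ (k + 4) * ((10 * (k * 2 ^ (k - 1)) : ℕ) : ℝ) = 5 / 16 := by
    have hk0 : (k : ℝ) ≠ 0 := by positivity
    obtain ⟨j, rfl⟩ : ∃ j, k = j + 1 := ⟨k - 1, by omega⟩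
    simp only [Nat.add_sub_cancel]
    push_cast
    rw [show j + 1 + 4 = j + 5 by ring, pow_add, inv_pow]
    field_simp
    ring
  have h := (tendsto_rpow_neg_atTop (show (0 : ℝ) < 11 / 16 by norm_num)).comp
    (tendsto_natCast_atTop_atTop (R := ℝ))
  refine h.congr' ?_
  filter_upwards [eventually_ge_atTop 1] with N hN
  have hN0 : (0 : ℝ) < N := by exact_mod_cast hN
  simp only [Function.comp_def]
  rw [gyLevel_def, ← Real.rpow_natCast, ← Real.rpow_mul hN0.le, hexp,
    show (-(11 / 16) : ℝ) = 5 / 16 - 1 by norm_num, Real.rpow_sub hN0, Real.rpow_one]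

/-- **Green–Tao 2008, Proposition 9.8** ("The function `ν` satisfies the
`(k·2^{k-1}, 3k-4, k)`-linear forms condition"), derived from Proposition 9.5
(`GoldstonYildirimLinearForms`) exactly as printed (pp. 526–528), via
`linearFormsCondition_of_boxAsymptotic` applied to `F_N(n) = (φ(W)/W) Λ_R(W n + 1)² / log R`.
The growth bound is `G = min(min_{m ≤ k2^{k-1}, t ≤ 3k-4} G_{9.5}(k, m, t), ⌊log_4 log N⌋)`;
the coefficient bound `(k+1)!`-type constant `k · k! ≤ √(w(N))/2` holds for large `N` as
`w → ∞` ("we may assume that `(k+1)! < √(w(N))/2` by taking `N` sufficiently large").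
[cite: GreenTaoAnnals2008, Proposition 9.8] -/
theorem MeasureLinearForms_of (h95 : GoldstonYildirimLinearForms) : MeasureLinearForms := by
  classical
  intro k hk
  have hk1 : 1 ≤ k := by omega
  set m₀ : ℕ := k * 2 ^ (k - 1) with hm₀_def
  set t₀ : ℕ := 3 * k - 4 with ht₀_def
  have hm₀1 : 1 ≤ m₀ := Nat.mul_pos hk1 (Nat.two_pow_pos _)
  have ht₀1 : 1 ≤ t₀ := by omega
  have h95' : ∀ mt : ℕ × ℕ, 1 ≤ mt.1 → 1 ≤ mt.2 → ∃ G : ℕ → ℕ, Tendsto G atTop atTop ∧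
      ∀ w : ℕ → ℕ, Tendsto w atTop atTop → (∀ N, w N ≤ G N) →
        ∀ ε : ℝ, 0 < ε → ∀ᶠ N : ℕ in atTop, N.Prime →
          ∀ L : Fin mt.1 → Fin mt.2 → ℤ, (∀ i j, (|L i j| : ℝ) ≤ Real.sqrt (w N) / 2) →
            (∀ i, L i ≠ 0) →
            (∀ i i', i ≠ i' → ∀ c : ℚ, (fun j => (L i j : ℚ)) ≠ c • fun j => (L i' j : ℚ)) →
            ∀ b : Fin mt.1 → ℤ, ∀ a : Fin mt.2 → ℤ, ∀ ℓ : Fin mt.2 → ℕ,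
              (∀ j, gyLevel k N ^ (10 * mt.1) ≤ ℓ j) →
              |(𝔼 x ∈ Fintype.piFinset fun j => Ico (a j) (a j + ℓ j),
                  ∏ i, truncatedDivisorSum (gyLevel k N)
                    (primorial (w N) * (∑ j, L i j * x j + b i) + 1) ^ 2) /
                ((primorial (w N) : ℝ) * Real.log (gyLevel k N) /
                  Nat.totient (primorial (w N))) ^ mt.1 - 1| ≤ ε :=
    fun mt h1 h2 => h95 k mt.1 mt.2 hk h1 h2
  choose! G hG H using h95'
  set I : Finset (ℕ × ℕ) := Icc 1 m₀ ×ˢ Icc 1 t₀ with hI_def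
  have hIne : I.Nonempty := ⟨(1, 1), by simp [hI_def, hm₀1, ht₀1]⟩
  set Gmin : ℕ → ℕ := fun N => I.inf' hIne (fun mt => G mt N) with hGmin_def
  have hGmin : Tendsto Gmin atTop atTop := by
    rw [Filter.tendsto_atTop]
    intro b
    have hall : ∀ᶠ N in atTop, ∀ mt ∈ I, b ≤ G mt N :=
      (Filter.eventually_all_finset _).2 fun mt hmt => by
        have h1 : 1 ≤ mt.1 := (mem_Icc.1 (mem_product.1 hmt).1).1
        have h2 : 1 ≤ mt.2 := (mem_Icc.1 (mem_product.1 hmt).2).1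
        exact Filter.tendsto_atTop.1 (hG mt h1 h2) b
    filter_upwards [hall] with N hN
    exact Finset.le_inf' _ _ hN
  have hGminle : ∀ mt ∈ I, ∀ N, Gmin N ≤ G mt N := fun mt hmt N => Finset.inf'_le _ hmt
  have hfl : Tendsto (fun N : ℕ => ⌊Real.logb 4 (Real.log N)⌋₊) atTop atTop :=
    tendsto_nat_floor_atTop.comp ((Real.tendsto_logb_atTop (by norm_num)).comp
      (Real.tendsto_log_atTop.comp tendsto_natCast_atTop_atTop))
  refine ⟨fun N => min (Gmin N) ⌊Real.logb 4 (Real.log N)⌋₊, tendsto_inf_atTop atTop hGmin hfl,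
    fun w hw hwG => ?_⟩
  have hwG' : ∀ mt ∈ I, ∀ N, w N ≤ G mt N := fun mt hmt N =>
    (hwG N).trans ((min_le_left _ _).trans (hGminle mt hmt N))
  -- the function `F_N`
  set F : ℕ → ℤ → ℝ := fun N n =>
    (Nat.totient (primorial (w N)) : ℝ) / primorial (w N) *
      truncatedDivisorSum (gyLevel k N) (primorial (w N) * n + 1) ^ 2 / Real.log (gyLevel k N)
    with hF_def
  have hF0 : ∀ N n, 0 ≤ F N n := fun N n =>
    div_nonneg (mul_nonneg (div_nonneg (Nat.cast_nonneg _) (Nat.cast_nonneg _)) (sq_nonneg _))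
      (log_gyLevel_nonneg k N)
  have hν : ∀ N (x : ZMod N), gtMeasure k w N x = if InWindow (eps k) N x.val then F N x.val else 1 := by
    intro N x
    by_cases hc : eps k * N ≤ (x.val : ℝ) ∧ (x.val : ℝ) ≤ 2 * eps k * N
    · have hc' : InWindow (eps k) N x.val := by simpa [InWindow] using hc
      rw [if_pos hc']
      unfold gtMeasure
      rw [if_pos hc]
    · have hc' : ¬ InWindow (eps k) N x.val := by simpa [InWindow] using hc
      rw [if_neg hc']
      unfold gtMeasure
      rw [if_neg hc]
  have hε2 : 2 * eps k < 1 := two_mul_eps_lt_one k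
  -- shared eventualities
  have hlogR1 : ∀ᶠ N : ℕ in atTop, 1 ≤ Real.log (gyLevel k N) := by
    have hc : 0 < (k : ℝ)⁻¹ * 2⁻¹ ^ (k + 4) := by
      have : (0 : ℝ) < k := by exact_mod_cast hk1
      positivity
    have ht : Tendsto (fun N : ℕ => Real.log (gyLevel k N)) atTop atTop := by
      simp_rw [log_gyLevel]
      exact Tendsto.const_mul_atTop hc (Real.tendsto_log_atTop.comp tendsto_natCast_atTop_atTop)
    exact ht.eventually_ge_atTop 1
  have hcoef : ∀ᶠ N : ℕ in atTop, ((k * k.factorial : ℕ) : ℝ) ≤ Real.sqrt (w N) / 2 := by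
    have h1 : Tendsto (fun N => Real.sqrt (w N) / 2) atTop atTop := by
      refine Tendsto.atTop_div_const (by norm_num) ?_
      exact Real.tendsto_sqrt_atTop.comp (tendsto_natCast_atTop_atTop.comp hw)
    exact h1.eventually_ge_atTop _
  refine linearFormsCondition_of_boxAsymptotic F (eps_pos k) hε2 hν hF0
    (fun N => gyLevel k N ^ (10 * m₀)) (tendsto_gyLevel_pow_div_atTop hk1) ?_
  -- the linear forms asymptotic from Proposition 9.5
  intro m t hm1 hmm₀ ht1 htt₀ ε hε
  have hmt : (m, t) ∈ I := by
    simp only [hI_def, mem_product, mem_Icc]; exact ⟨⟨hm1, hmm₀⟩, ht1, htt₀⟩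
  have hev := H (m, t) hm1 ht1 w hw (hwG' (m, t) hmt) ε hε
  filter_upwards [hev, hlogR1, hcoef, eventually_ge_atTop 1] with N hN hlogR hcoefN hN1 hNp L hL hL0 hLp
    b a ℓ hℓ
  -- sizes at level N
  set W : ℕ := primorial (w N) with hW_def
  set R : ℝ := gyLevel k N with hR_def
  have hW0 : (0 : ℝ) < W := by exact_mod_cast primorial_pos (w N)
  have hφ0 : (0 : ℝ) < Nat.totient W := by exact_mod_cast Nat.totient_pos.2 (primorial_pos (w N))
  have hlogR0 : 0 < Real.log R := by simp only [hR_def]; linarith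
  have hR1 : 1 ≤ R := one_le_gyLevel hN1
  set M : ℝ := (W : ℝ) * Real.log R / Nat.totient W with hM_def
  have hM0 : 0 < M := by positivity
  have hFM : ∀ z : ℤ, F N z = M⁻¹ * truncatedDivisorSum R ((W : ℤ) * z + 1) ^ 2 := by
    intro z
    simp only [hF_def, hM_def, hW_def, hR_def]
    field_simp
  -- Proposition 9.5 applies: coefficients and boxes
  have hL' : ∀ i j, (|L i j| : ℝ) ≤ Real.sqrt (w N) / 2 := by
    intro i j
    have h1 : (|L i j| : ℝ) ≤ ((k * k.factorial : ℕ) : ℝ) := by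
      have := hL i j
      exact_mod_cast this
    exact h1.trans hcoefN
  have hℓ' : ∀ j, gyLevel k N ^ (10 * m) ≤ ℓ j := by
    intro j
    refine le_trans ?_ (hℓ j)
    exact pow_le_pow_right₀ hR1 (by nlinarith)
  have h95N := hN hNp L hL' hL0 hLp b a ℓ hℓ'
  -- normalise
  have hprod : ∀ x : Fin t → ℤ, ∏ i, F N (∑ j, L i j * x j + b i) =
      M⁻¹ ^ m * ∏ i, truncatedDivisorSum R ((W : ℤ) * (∑ j, L i j * x j + b i) + 1) ^ 2 := by
    intro x
    rw [prod_congr rfl fun i _ => hFM _, prod_mul_distrib, prod_const, card_univ, Fintype.card_fin]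
  simp_rw [hprod]
  rw [← mul_expect, inv_pow, ← div_eq_inv_mul]
  exact h95N


/-! ### The reductions achieved -/

/-- **Green–Tao 2008, Proposition 9.1 from Propositions 9.5 and 9.6** (pp. 524–530 in full:
Lemma 9.4, Props. 9.8 and 9.10 with Lemma 9.9, and the assembly on p. 530 are all proved; only
the two Goldston–Yıldırım estimates remain named facts).
[cite: GreenTaoAnnals2008, Proposition 9.1 (proof, pp. 524–530)] -/
theorem PseudorandomMajorant_of_goldstonYildirim (h95 : GoldstonYildirimLinearForms)
    (h96 : GoldstonYildirimCorrelations) : PseudorandomMajorant :=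
  PseudorandomMajorant_of (MeasureLinearForms_of h95) (MeasureCorrelation_of h96)

end Literature.NumberTheory.Sieve.GreenTao2008

namespace Literature.NumberTheory.Sieve

open GreenTao2008

/-- **Green–Tao 2008, Theorem 1.1 from Theorem 3.5 and the Goldston–Yıldırım Propositions 9.5,
9.6**: the primes contain a `k`-term arithmetic progression for every `k`, granted the relative
Szemerédi theorem (Thm. 3.5, §§4–8) and the two correlation estimates for `Λ_R` (§10 and the
Appendix); everything else in the paper's deduction (§9 in full and the p. 523 Dirichlet-type
input) is proved in the tree. [cite: GreenTaoAnnals2008, Theorem 1.1 (proof, pp. 523–530)] -/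
theorem exists_prime_arithmetic_progression_of_goldstonYildirim (h₂ : RelativeSzemeredi)
    (h95 : GoldstonYildirimLinearForms) (h96 : GoldstonYildirimCorrelations) :
    exists_prime_arithmetic_progression :=
  exists_prime_arithmetic_progression_of_greenTao h₂
    (PseudorandomMajorant_of_goldstonYildirim h95 h96) ModifiedVonMangoldtSum_holds

end Literature.NumberTheory.Sieve
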